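import Mathlib
import Literature.NumberTheory.Irrationality.RhinViola2001.ContourIntegralResidues
import Literature.NumberTheory.Irrationality.RhinViola2001.Theorem21Proofs
import Literature.NumberTheory.Irrationality.RhinViola2001.TheoremTwoOneProofs
import Literature.NumberTheory.Transcendental.AperyIrrationality
import HarnessLib

/-!
# Rhin–Viola 2001, §3 — II: Theorem 3.1 (`b = Ĩ`) and Lemma 3.1, by the descent of Theorem 2.1

Topic `Literature/NumberTheory/Irrationality/RhinViola2001`. Second of two files (cell `zeta5-irr`, seat zi-lit g16)
DISCHARGING the named fact `theorem31` of `GroupStructure.lean` (`theorem31_holds` below): G. Rhin, C. Viola,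
*The group structure for ζ(3)*, Acta Arith. **97** (2001) 269–293 [RhinViola2001], §3 pp. 276–279 (read on the page):

* **Theorem 3.1.** "Under the assumptions of Theorem 2.1, the integer `b` in (2.9) is given by
  `b = (2πi)^{−3} ∫_C ∫_{C_x} ∫_{C_{x,y}} x^h(1−x)^l y^k(1−y)^s z^j(1−z)^q/(1−(1−xy)z)^{q+h−r} · dx dy dz/(1−(1−xy)z)`,
  where `C`, `C_x` and `C_{x,y}` are as in Lemma 3.1."
* **Lemma 3.1.** "`Ĩ(h,j,k,l,m,q,r,s) = Ĩ(j,k,l,m,q,r,s,h) = Ĩ(k,j,h,s,r,q,m,l)`" (for any `ρ₁, ρ₂, ρ₃ > 0`).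

## The printed proof and the road taken here

Printed (p. 278–279): "We apply to the integral `Ĩ` … step by step, the same linear decomposition (2.10) and the same
permutations lying in `Θ = ⟨ϑ, σ⟩` used for `I` in the proof of Theorem 2.1, and we can do this by Lemma 3.1. `Ĩ`
vanishes if `q + h − r < 0`, and therefore, by Lemma 3.1, it also vanishes if the least of the integers (2.8) is `< 0`.
Thus we have … (3.7) `I = Σ_t β_t I^{(t)} + (rational number)` and (3.8) `Ĩ = Σ_t β_t Ĩ^{(t)}` with the same
`β_t ∈ ℤ` … (3.9) `I^{(t)} = −2Σ_{ν=1}^{h_t} ν^{−3} + 2ζ(3)` … `Ĩ^{(t)} = 1`. Therefore, by (3.8), (3.10) `Ĩ = Σ_t β_t`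
… whence, by the irrationality of `ζ(3)` and by (3.10), `b = Σ_t β_t = Ĩ`."

Here (part I, `ContourIntegralResidues.lean`, gave the CLOSED FORM `Ĩ = A(P)` — `Theorem31.Acoef` — for every
non-negative parameter set): the SAME descent, organised as the tree's proof of Theorem 2.1 (`Theorem21.step`,
an induction on `h+j+⋯+s`), run on the statement "`I(P) − 2·A(P)·ζ(3) ∈ ℚ`" (`Theorem31.main`):
* "`Ĩ` vanishes if … the least of the integers (2.8) is `< 0`": for the closed form each of these eight cases is an
  EMPTY SUM (`Acoef_eq_zero`, `bInt_eq_zero_of_aux_neg`) — this replaces the source's appeal to Lemma 3.1 — while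
  `I` is rational there (`rational_of_aux_neg`, the polynomial case of Theorem 2.1 after a rotation, tree lemmas
  `Theorem21.exists_int_of_lt`, `Theorem21.I_rot`);
* the linear decomposition (2.10) AND ITS SEVEN `ϑ`-CONJUGATES are integrand identities
  (`(1−x)(1−z) = 1−x−(1−x)z`, `(1−y)(1−z) = 1−y−(1−y)z`, `x(1−y)(1−z) = (1−(1−xy)z) − xy − (1−x)(1−z)`, …), hence
  hold for `Ĩ` by linearity of the three circle integrals (`contourI_rel`, `contourI_R0` … `contourI_R7`) and for
  `I` by the tree's `Theorem21.I_decomp` transported along `Theorem21.I_rot` (`I_R`) — so the descent never has to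
  rotate the contour integral (which is where the source uses Lemma 3.1);
* the terminal parameters are `(t,0,t,0,t,0,t,0)` and `(0,t,0,t,0,t,0,t)` (`terminal_cases`, the printed case
  analysis p. 275), where `Ĩ = A = 1` (`Acoef_baseA`, `Acoef_baseB` — the computation (3.9)–(3.10)) and
  `I = 2ζ(3) − 2Σν^{−3}` (tree `Theorem21.I_baseP`, (2.11));
* "by the irrationality of `ζ(3)`" (tree `Transcendental.irrational_zeta_three`): `b = A(P) = Ĩ`
  (`theorem31_holds`), and THEN Lemma 3.1 (`lemma31_theta`, `lemma31_sigma`) from the `Θ`-invariance of `I`.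

DEVIATION (named): Lemma 3.1 is obtained after Theorem 3.1, not before (no multivariable contour deformation in
Mathlib; see part I). Everything is PROVED: no definition of the source changed, no named fact, no new hypothesis.
By-product: `b(P) = A(P)` is an explicit double binomial-coefficient sum for the `ζ(3)`-coefficient of every
Rhin–Viola integral (`contourI_eq_bInt` with `theorem31_b_eq`).

HONEST FRAMING (cells pub-zeta5 / zeta5-irr): Rhin–Viola's `ζ(3)` bookkeeping AS PRINTED in 2001; nothing here
concerns `ζ(5)`; no record is moved.
-/

noncomputable section

open MeasureTheory Set Metric Polynomial Finset

namespace Literature.NumberTheory.Irrationality.RhinViola2001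

namespace Theorem31

open Literature.NumberTheory.Transcendental (zetaValue)
open Literature.NumberTheory.Transcendental.Apery (irrational_zeta_three)
open Theorem21

/-! ### The integer data `[u^c](u^a(1−u)^b)` -/

/-- `[u^c](u^a(1−u)^b) = 0` for `c < a`. [cite: RhinViola2001, §3 (3.9)–(3.10)] -/
theorem bc_eq_zero_of_lt {a b c : ℕ} (h : c < a) : bc a b c = 0 := by
  rw [bc, coeff_X_pow_mul', if_neg (by omega)]

/-- `[u^{a+i}](u^a(1−u)^b) = (−1)^i C(b,i)`. [cite: RhinViola2001, §3 (3.9)–(3.10)] -/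
theorem bc_add (a b i : ℕ) : bc a b (a + i) = (-1) ^ i * (b.choose i : ℤ) := by
  rw [bc, coeff_X_pow_mul', if_pos (by omega), Nat.add_sub_cancel_left]
  have h1 : (1 - X : ℤ[X]) = C (-1) * (X + C (-1)) := by
    rw [mul_add, ← C_mul]; simp; ring
  rw [h1, mul_pow, ← C_pow, coeff_C_mul, coeff_X_add_C_pow]
  by_cases hi : i ≤ b
  · obtain ⟨d, rfl⟩ := Nat.exists_eq_add_of_le hi
    rw [Nat.add_sub_cancel_left, pow_add]
    have : ((-1 : ℤ) ^ d) * (-1) ^ d = 1 := by rw [← mul_pow]; simp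
    linear_combination ((-1 : ℤ) ^ i * ((i + d).choose i : ℤ)) * this
  · rw [Nat.choose_eq_zero_of_lt (by omega)]; simp

/-- `[u^c](u^a(1−u)^b) = 0` for `c > a + b`. [cite: RhinViola2001, §3 (3.9)–(3.10)] -/
theorem bc_eq_zero_of_gt {a b c : ℕ} (h : a + b < c) : bc a b c = 0 := by
  obtain ⟨i, rfl⟩ : ∃ i, c = a + i := ⟨c - a, by omega⟩
  rw [bc_add, Nat.choose_eq_zero_of_lt (by omega)]; simp

/-- `[u^a](u^a(1−u)^b) = 1`. [cite: RhinViola2001, §3 (3.9)–(3.10)] -/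
theorem bc_self (a b : ℕ) : bc a b a = 1 := by
  simpa using bc_add a b 0

/-- `[u^{a+b}](u^a(1−u)^b) = (−1)^b`. [cite: RhinViola2001, §3 (3.9)–(3.10)] -/
theorem bc_top (a b : ℕ) : bc a b (a + b) = (-1) ^ b := by
  simp [bc_add]

/-! ### "`Ĩ` vanishes … if the least of the integers (2.8) is `< 0`": empty sums -/

/-- **Vanishing of the closed form.** With `n = q+h−r`, `u = a+n`, `v = a+b+n`, a non-zero term of `A` needs
`j ≤ u ≤ j+q`, `k ≤ v ≤ k+s`, `h ≤ v ≤ h+l`, `n ≤ u ≤ v`; each of the listed inequalities (the negativity of one of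
`h′, l′, s′, k′, j′, r′, m′` of (2.8), rewritten with (2.2)–(2.3)) empties the sum. [cite: RhinViola2001, §3 p. 278–279
("`Ĩ` … vanishes if the least of the integers (2.8) is `< 0`")] -/
theorem Acoef_eq_zero {h j k l q s n : ℕ}
    (H : h + l < j ∨ h + l < k ∨ k + s < h ∨ k + s < j ∨ j + q < n ∨ h + l < n ∨ k + s < n) :
    Acoef h j k l q s n = 0 := by
  unfold Acoef
  refine Finset.sum_eq_zero fun a _ => Finset.sum_eq_zero fun b _ => ?_
  by_cases h1 : a + n < j
  · rw [bc_eq_zero_of_lt h1]; simp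
  by_cases h2 : j + q < a + n
  · rw [bc_eq_zero_of_gt h2]; simp
  by_cases h3 : b + (n + a) < k
  · rw [bc_eq_zero_of_lt (a := k) h3]; simp
  by_cases h4 : k + s < b + (n + a)
  · rw [bc_eq_zero_of_gt (a := k) h4]; simp
  by_cases h5 : h ≤ n + a + b
  · rw [if_pos h5]
    by_cases h6 : 0 + l < n + a + b - h
    · rw [bc_eq_zero_of_gt h6]; simp
    · exfalso; omega
  · rw [if_neg h5]; simp

/-! ### "`Ĩ^{(t)} = 1`" ((3.9)–(3.10)): the two terminal families -/

/-- `A(t,0,t,0,t,0,t,0) = 1` — the computation (3.9)–(3.10) `Ĩ^{(t)} = 1` (here `n = q+h−r = 0`).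
[cite: RhinViola2001, §3 (3.9)–(3.10)] -/
theorem Acoef_baseA (t : ℕ) : Acoef t 0 t 0 0 0 0 = 1 := by
  unfold Acoef
  rw [zero_add, zero_add, Finset.sum_range_one, Finset.sum_eq_single t]
  · simp [bc_self]
  · intro b _ hb
    rcases Nat.lt_or_gt_of_ne hb with hb' | hb'
    · rw [bc_eq_zero_of_lt (a := t) (by simpa using hb')]; simp
    · rw [bc_eq_zero_of_gt (a := t) (by simpa using hb')]; simp
  · intro ht; exact absurd (Finset.mem_range.mpr (by omega)) ht

/-- `A(0,t,0,t,0,t,0,t) = 1` — the other `ϑ`-orbit representative of (2.11) (here `n = q+h−r = t`).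
[cite: RhinViola2001, §3 (3.9)–(3.10) with §2 p. 275] -/
theorem Acoef_baseB (t : ℕ) : Acoef 0 t 0 t t t t = 1 := by
  unfold Acoef
  rw [Finset.sum_eq_single 0]
  · rw [Finset.sum_eq_single 0]
    · have h1 : bc 0 t t = (-1) ^ t := by simpa using bc_top 0 t
      simp only [pow_zero, zero_add, add_zero, Nat.choose_self, Nat.cast_one, one_mul, bc_self, zero_le,
        if_true, Nat.sub_zero, h1, mul_one]
      rw [← mul_pow]; simp
    · intro b _ hb
      rw [bc_eq_zero_of_gt (a := 0) (b := t) (c := b + (t + 0)) (by omega)]; simp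
    · intro h0; exact absurd (Finset.mem_range.mpr (by omega)) h0
  · intro a _ ha
    refine Finset.sum_eq_zero fun b _ => ?_
    rw [bc_eq_zero_of_gt (a := 0) (b := t) (c := b + (t + a)) (by omega)]; simp
  · intro h0; exact absurd (Finset.mem_range.mpr (by omega)) h0

/-! ### The integer `Ĩ(P)` as a function of the parameters -/

/-- `Ĩ(P)` as an integer-valued function of non-negative parameters: the closed form `A` if `q+h−r ≥ 0`, else `0`.
[cite: RhinViola2001, §3 Theorem 3.1, p. 278] -/
def bInt (P : Params) : ℤ :=
  if P.r ≤ P.q + P.h then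
    Acoef P.h.toNat P.j.toNat P.k.toNat P.l.toNat P.q.toNat P.s.toNat (P.q + P.h - P.r).toNat
  else 0

/-- `Ĩ(P) = bInt P` for every non-negative `P` and all radii. [cite: RhinViola2001, §3 Theorem 3.1] -/
theorem contourI_eq_bInt {P : Params} (hP : P.Nonneg) {ρ₁ ρ₂ ρ₃ : ℝ} (h₁ : 0 < ρ₁) (h₂ : 0 < ρ₂)
    (h₃ : 0 < ρ₃) : contourI P ρ₁ ρ₂ ρ₃ = (bInt P : ℂ) := by
  rw [contourI_eq_Acoef hP h₁ h₂ h₃, bInt]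
  split_ifs <;> simp

/-- `bInt` at natural parameters. [cite: RhinViola2001, §3 Theorem 3.1] -/
theorem bInt_ofNat (h j k l m q r s : ℕ) :
    bInt (ofNat h j k l m q r s) = if r ≤ q + h then Acoef h j k l q s (q + h - r) else 0 := by
  simp only [bInt, ofNat, Int.toNat_natCast]
  by_cases hr : r ≤ q + h
  · rw [if_pos hr, if_pos (by exact_mod_cast hr), show ((q : ℤ) + h - r).toNat = q + h - r by omega]
  · rw [if_neg hr, if_neg (by exact_mod_cast hr)]

/-- "`Ĩ` vanishes if `q + h − r < 0`, and … also if the least of the integers (2.8) is `< 0`."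
[cite: RhinViola2001, §3 p. 278–279] -/
theorem bInt_eq_zero_of_aux_neg {P : Params} (hN : P.Nonneg) (hB : P.Balanced) (hneg : ∃ x ∈ P.S, x < 0) :
    bInt P = 0 := by
  obtain ⟨h, j, k, l, m, q, r, s, rfl⟩ := exists_eq_ofNat hN
  obtain ⟨b1, b2⟩ := hB
  simp only [ofNat] at b1 b2
  obtain ⟨x, hx, hx0⟩ := hneg
  simp only [Params.S, Params.toList, Params.aux, ofNat, List.mem_cons, List.not_mem_nil, or_false] at hx
  rw [bInt_ofNat]
  by_cases hr : r ≤ q + h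
  · rw [if_pos hr]
    apply Acoef_eq_zero
    omega
  · rw [if_neg hr]

/-- `bInt(t,0,t,0,t,0,t,0) = 1`. [cite: RhinViola2001, §3 (3.9)–(3.10)] -/
theorem bInt_baseP (t : ℕ) : bInt (baseP t) = 1 := by
  rw [show baseP (t : ℤ) = ofNat t 0 t 0 t 0 t 0 by rfl, bInt_ofNat, if_pos (by omega), Nat.zero_add,
    Nat.sub_self, Acoef_baseA]

/-- `bInt(0,t,0,t,0,t,0,t) = 1`. [cite: RhinViola2001, §3 (3.9)–(3.10) with §2 p. 275] -/
theorem bInt_theta_baseP (t : ℕ) : bInt (theta (baseP t)) = 1 := by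
  rw [show theta (baseP (t : ℤ)) = ofNat 0 t 0 t 0 t 0 t by rfl, bInt_ofNat, if_pos (by omega), Nat.add_zero,
    Nat.sub_zero, Acoef_baseB]


/-! ### Linearity of `Ĩ` in the integrand: integrability of the three successive integrands -/

/-- `ofNat` parameters are non-negative. [cite: RhinViola2001, Theorem 2.1] -/
theorem nonneg_ofNat (h j k l m q r s : ℕ) : (ofNat h j k l m q r s).Nonneg := by
  simp [Params.Nonneg, ofNat]

/-- The integrand (3.1) with the denominator as a power: `… · (1−(1−xy)z)^E`, `E = r − q − h − 1` (any syntactic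
form of `E`). [cite: RhinViola2001, §3 (3.1)] -/
theorem cI_nf (h j k l m q r s : ℕ) (E : ℤ) (hE : E = (r : ℤ) - q - h - 1) (x y z : ℂ) :
    contourIntegrand (ofNat h j k l m q r s) x y z
      = x ^ h * (1 - x) ^ l * y ^ k * (1 - y) ^ s * z ^ j * (1 - z) ^ q * (1 - (1 - x * y) * z) ^ E := by
  rw [contourIntegrand_ofNat, div_eq_mul_inv, ← zpow_neg, hE, show -((q : ℤ) + h - r + 1) = (r : ℤ) - q - h - 1 by ring]
  ring

/-- On a circle of positive radius the variable never meets the centre. [folklore] -/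
private theorem sub_ne_zero_of_mem_sphere' {c ζ : ℂ} {R : ℝ} (hR : 0 < R) (hζ : ζ ∈ sphere c R) : ζ - c ≠ 0 := by
  rw [sub_ne_zero]
  rintro rfl
  rw [mem_sphere, dist_self] at hζ
  exact hR.ne' hζ.symm

/-- On `C_{x,y}`: `1 − (1−xy)z ≠ 0`. [cite: RhinViola2001, §3 (3.1)] -/
theorem denom_ne_zero {x y z : ℂ} (hw : 1 - x * y ≠ 0) {ρ : ℝ} (hρ : 0 < ρ) (hz : z ∈ sphere (1 - x * y)⁻¹ ρ) :
    1 - (1 - x * y) * z ≠ 0 := by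
  have h1 : 1 - (1 - x * y) * z = -(1 - x * y) * (z - (1 - x * y)⁻¹) := by field_simp; ring
  rw [h1]
  exact mul_ne_zero (neg_ne_zero.mpr hw) (sub_ne_zero_of_mem_sphere' hρ hz)

/-- The integrand is circle integrable in `z` over `C_{x,y}` (continuous there). [cite: RhinViola2001, §3 (3.1)] -/
theorem circleIntegrable_z (h j k l m q r s : ℕ) {x y : ℂ} (hw : 1 - x * y ≠ 0) {ρ₃ : ℝ} (h₃ : 0 < ρ₃) :
    CircleIntegrable (fun z => contourIntegrand (ofNat h j k l m q r s) x y z) (1 - x * y)⁻¹ ρ₃ := by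
  refine ContinuousOn.circleIntegrable h₃.le ?_
  simp only [cI_nf h j k l m q r s _ rfl]
  have hD : ContinuousOn (fun z : ℂ => (1 - (1 - x * y) * z) ^ ((r : ℤ) - q - h - 1)) (sphere (1 - x * y)⁻¹ ρ₃) :=
    (continuousOn_const.sub (continuousOn_const.mul continuousOn_id)).zpow₀ _
      fun z hz => Or.inl (denom_ne_zero hw h₃ hz)
  apply ContinuousOn.mul _ hD
  apply ContinuousOn.mul _ ((continuousOn_const.sub continuousOn_id).pow q)
  apply ContinuousOn.mul _ (continuousOn_id.pow j)
  exact continuousOn_const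

/-- The `z`-integral in closed form (level `z`), for `1 − xy ≠ 0`. [cite: RhinViola2001, §3 (3.1), (3.9)] -/
theorem innerZ_ofNat (h j k l m q r s : ℕ) {x y : ℂ} (hw : 1 - x * y ≠ 0) {ρ₃ : ℝ} (h₃ : 0 < ρ₃) :
    (∮ z in C((1 - x * y)⁻¹, ρ₃), contourIntegrand (ofNat h j k l m q r s) x y z)
      = x ^ h * (1 - x) ^ l * y ^ k * (1 - y) ^ s * (2 * Real.pi * Complex.I *
          ((-(1 - x * y)) ^ (-((q : ℤ) + h - r + 1)) *
            tcoeff (pC j q) (1 - x * y)⁻¹ ((q : ℤ) + h - r + 1 - 1))) := by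
  simp_rw [contourIntegrand_ofNat]
  rw [circleIntegral.integral_const_mul, level_z j q _ hw h₃]

/-- `c ↦ [u^m]p(c+u)` is continuous (a polynomial in `c`). [cite: RhinViola2001, §3 (3.9)–(3.10)] -/
theorem continuous_tcoeff (p : ℂ[X]) (m : ℤ) : Continuous fun c => tcoeff p c m := by
  unfold tcoeff
  split_ifs
  · simp_rw [taylor_coeff]; exact Polynomial.continuous _
  · exact continuous_const

/-- The `z`-integral, as a function of `y`, is circle integrable over `C_x` (`x ≠ 0`). [cite: RhinViola2001, §3 (3.1)] -/
theorem circleIntegrable_y (h j k l m q r s : ℕ) {x : ℂ} (hx : x ≠ 0) {ρ₂ ρ₃ : ℝ} (h₂ : 0 < ρ₂) (h₃ : 0 < ρ₃) :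
    CircleIntegrable (fun y => ∮ z in C((1 - x * y)⁻¹, ρ₃), contourIntegrand (ofNat h j k l m q r s) x y z)
      (1 / x) ρ₂ := by
  have hEq : EqOn (fun y => ∮ z in C((1 - x * y)⁻¹, ρ₃), contourIntegrand (ofNat h j k l m q r s) x y z)
      (fun y => x ^ h * (1 - x) ^ l * y ^ k * (1 - y) ^ s * (2 * Real.pi * Complex.I *
          ((-(1 - x * y)) ^ (-((q : ℤ) + h - r + 1)) *
            tcoeff (pC j q) (1 - x * y)⁻¹ ((q : ℤ) + h - r + 1 - 1)))) (sphere (1 / x) |ρ₂|) := by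
    intro y hy
    rw [abs_of_pos h₂] at hy
    exact innerZ_ofNat h j k l m q r s (one_sub_mul_ne_zero hx h₂ hy) h₃
  refine (circleIntegrable_congr hEq).mpr (ContinuousOn.circleIntegrable h₂.le ?_)
  have hw : ∀ y ∈ sphere (1 / x) ρ₂, 1 - x * y ≠ 0 := fun y hy => one_sub_mul_ne_zero hx h₂ hy
  have hc : ContinuousOn (fun y : ℂ => 1 - x * y) (sphere (1 / x) ρ₂) :=
    continuousOn_const.sub (continuousOn_const.mul continuousOn_id)
  refine ((continuousOn_const.mul (continuousOn_id.pow k)).mul ((continuousOn_const.sub continuousOn_id).pow s)).mul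
    (continuousOn_const.mul ?_)
  refine (hc.neg.zpow₀ _ fun y hy => Or.inl (neg_ne_zero.mpr (hw y hy))).mul ?_
  exact (continuous_tcoeff _ _).comp_continuousOn (hc.inv₀ hw)

/-- The double integral over `C_x`, `C_{x,y}` in closed form (levels `z`, `y`), for `x ≠ 0`.
[cite: RhinViola2001, §3 (3.1), (3.9)] -/
theorem innerYZ_ofNat (h j k l m q r s : ℕ) {x : ℂ} (hx : x ≠ 0) {ρ₂ ρ₃ : ℝ} (h₂ : 0 < ρ₂) (h₃ : 0 < ρ₃) :
    (∮ y in C(1 / x, ρ₂), ∮ z in C((1 - x * y)⁻¹, ρ₃), contourIntegrand (ofNat h j k l m q r s) x y z)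
      = if r ≤ q + h then
          (2 * Real.pi * Complex.I) ^ 2 * ∑ a ∈ range (j + q + 1), ∑ b ∈ range (k + s + 1),
            ((a + (q + h - r)).choose (q + h - r) : ℂ) * (pC j q).coeff (a + (q + h - r)) *
              (((b + ((q + h - r) + a)).choose ((q + h - r) + a) : ℂ) * (pC k s).coeff (b + ((q + h - r) + a))) *
                ((-1) ^ a * (x ^ h * (1 - x) ^ l * (x ^ ((q + h - r) + 1 + a + b))⁻¹))
        else 0 := by
  by_cases hr : r ≤ q + h
  · rw [if_pos hr]
    obtain ⟨n, hn⟩ : ∃ n : ℕ, n = q + h - r := ⟨_, rfl⟩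
    rw [← hn]
    have he : (q : ℤ) + h - r + 1 = ((n + 1 : ℕ) : ℤ) := by push_cast; omega
    have he' : (q : ℤ) + h - r + 1 - 1 = (n : ℤ) := by omega
    have hz' : ∀ y : ℂ, 1 - x * y ≠ 0 →
        (∮ z in C((1 - x * y)⁻¹, ρ₃), contourIntegrand (ofNat h j k l m q r s) x y z)
          = (2 * Real.pi * Complex.I * (x ^ h * (1 - x) ^ l)) * (y ^ k * (1 - y) ^ s *
              (((-(1 - x * y)) ^ (n + 1))⁻¹ * (hasseDeriv n (pC j q)).eval (1 - x * y)⁻¹)) := by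
      intro y hw
      rw [innerZ_ofNat h j k l m q r s hw h₃, he', tcoeff_natCast, he, zpow_neg, zpow_natCast]
      ring
    rw [circleIntegral.integral_congr h₂.le (fun y hy => hz' y (one_sub_mul_ne_zero hx h₂ hy)),
      circleIntegral.integral_const_mul, level_y k s n (pC j q) (natDegree_pC_lt j q) hx h₂]
    rw [Finset.mul_sum, Finset.mul_sum, Finset.mul_sum]
    refine Finset.sum_congr rfl fun a _ => ?_
    rw [hasseDeriv_eval_eq_sum (pC k s) (n + a) _ (natDegree_pC_lt k s), Finset.mul_sum, Finset.mul_sum,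
      Finset.mul_sum, Finset.mul_sum, Finset.mul_sum]
    refine Finset.sum_congr rfl fun b _ => ?_
    rw [one_div, inv_pow, pow_add x (n + 1 + a) b, mul_inv]
    ring
  · rw [if_neg hr]
    have hz0 : ∀ y : ℂ, 1 - x * y ≠ 0 →
        (∮ z in C((1 - x * y)⁻¹, ρ₃), contourIntegrand (ofNat h j k l m q r s) x y z) = 0 := by
      intro y hw
      rw [innerZ_ofNat h j k l m q r s hw h₃, tcoeff_of_neg _ _ (by omega)]
      simp
    rw [circleIntegral.integral_congr h₂.le (fun y hy => hz0 y (one_sub_mul_ne_zero hx h₂ hy))]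
    simp [circleIntegral]

/-- The double integral, as a function of `x`, is circle integrable over `C`. [cite: RhinViola2001, §3 (3.1)] -/
theorem circleIntegrable_x (h j k l m q r s : ℕ) {ρ₁ ρ₂ ρ₃ : ℝ} (h₁ : 0 < ρ₁) (h₂ : 0 < ρ₂) (h₃ : 0 < ρ₃) :
    CircleIntegrable (fun x => ∮ y in C(1 / x, ρ₂), ∮ z in C((1 - x * y)⁻¹, ρ₃),
      contourIntegrand (ofNat h j k l m q r s) x y z) 0 ρ₁ := by
  have hEq := fun x (hx : x ∈ sphere (0 : ℂ) |ρ₁|) =>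
    innerYZ_ofNat h j k l m q r s (ne_zero_of_mem_sphere_zero h₁ (by rwa [abs_of_pos h₁] at hx)) h₂ h₃
  refine (circleIntegrable_congr hEq).mpr ?_
  split_ifs
  · refine ContinuousOn.circleIntegrable h₁.le (continuousOn_const.mul ?_)
    refine continuousOn_finsetSum _ fun a _ => continuousOn_finsetSum _ fun b _ => ?_
    refine continuousOn_const.mul (continuousOn_const.mul ?_)
    refine ((continuousOn_id.pow _).mul ((continuousOn_const.sub continuousOn_id).pow _)).mul ?_
    exact (continuousOn_id.pow _).inv₀ fun x hx => pow_ne_zero _ (ne_zero_of_mem_sphere_zero h₁ hx)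
  · exact circleIntegrable_const 0 0 ρ₁

/-- `∮(f − g − k) = ∮f − ∮g − ∮k` for circle-integrable `f, g, k`. [folklore] -/
private theorem cint_sub_sub {f g k : ℂ → ℂ} {c : ℂ} {R : ℝ} (hf : CircleIntegrable f c R)
    (hg : CircleIntegrable g c R) (hk : CircleIntegrable k c R) :
    (∮ z in C(c, R), (f z - g z - k z)) = (∮ z in C(c, R), f z) - (∮ z in C(c, R), g z) - ∮ z in C(c, R), k z := by
  have e1 : (∮ z in C(c, R), (f z - g z - k z)) = (∮ z in C(c, R), (f z - g z)) - ∮ z in C(c, R), k z :=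
    circleIntegral.integral_sub (hf.sub hg) hk
  rw [e1, circleIntegral.integral_sub hf hg]

/-- **Linearity of `Ĩ` along an integrand identity.** If the integrands of four parameter sets (naturals) satisfy
`F_P = F_A − F_B − F_C` wherever `x ≠ 0`, `1 − xy ≠ 0`, `1 − (1−xy)z ≠ 0` (in particular on the three circles), then
`Ĩ(P) = Ĩ(A) − Ĩ(B) − Ĩ(C)` — the contour counterpart of the linear decomposition (2.10) ("We apply to the integral `Ĩ`
… the same linear decomposition (2.10)"). [cite: RhinViola2001, §3 p. 278 (proof of Theorem 3.1)] -/
theorem contourI_rel {P A B C : Params} (hP : ∃ h j k l m q r s : ℕ, P = ofNat h j k l m q r s)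
    (hA : ∃ h j k l m q r s : ℕ, A = ofNat h j k l m q r s) (hB : ∃ h j k l m q r s : ℕ, B = ofNat h j k l m q r s)
    (hC : ∃ h j k l m q r s : ℕ, C = ofNat h j k l m q r s) {ρ₁ ρ₂ ρ₃ : ℝ} (h₁ : 0 < ρ₁) (h₂ : 0 < ρ₂)
    (h₃ : 0 < ρ₃)
    (hid : ∀ x y z : ℂ, x ≠ 0 → 1 - x * y ≠ 0 → 1 - (1 - x * y) * z ≠ 0 →
      contourIntegrand P x y z = contourIntegrand A x y z - contourIntegrand B x y z - contourIntegrand C x y z) :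
    contourI P ρ₁ ρ₂ ρ₃ = contourI A ρ₁ ρ₂ ρ₃ - contourI B ρ₁ ρ₂ ρ₃ - contourI C ρ₁ ρ₂ ρ₃ := by
  obtain ⟨_, _, _, _, _, _, _, _, rfl⟩ := hP
  obtain ⟨_, _, _, _, _, _, _, _, rfl⟩ := hA
  obtain ⟨_, _, _, _, _, _, _, _, rfl⟩ := hB
  obtain ⟨_, _, _, _, _, _, _, _, rfl⟩ := hC
  unfold contourI
  rw [← mul_sub, ← mul_sub]
  congr 1
  refine Eq.trans ?_ (cint_sub_sub (circleIntegrable_x _ _ _ _ _ _ _ _ h₁ h₂ h₃)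
    (circleIntegrable_x _ _ _ _ _ _ _ _ h₁ h₂ h₃) (circleIntegrable_x _ _ _ _ _ _ _ _ h₁ h₂ h₃))
  refine circleIntegral.integral_congr h₁.le fun x hx => ?_
  have hx0 := ne_zero_of_mem_sphere_zero h₁ hx
  refine Eq.trans ?_ (cint_sub_sub (circleIntegrable_y _ _ _ _ _ _ _ _ hx0 h₂ h₃)
    (circleIntegrable_y _ _ _ _ _ _ _ _ hx0 h₂ h₃) (circleIntegrable_y _ _ _ _ _ _ _ _ hx0 h₂ h₃))
  refine circleIntegral.integral_congr h₂.le fun y hy => ?_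
  have hw := one_sub_mul_ne_zero hx0 h₂ hy
  refine Eq.trans ?_ (cint_sub_sub (circleIntegrable_z _ _ _ _ _ _ _ _ hw h₃)
    (circleIntegrable_z _ _ _ _ _ _ _ _ hw h₃) (circleIntegrable_z _ _ _ _ _ _ _ _ hw h₃))
  refine circleIntegral.integral_congr h₃.le fun z hz => ?_
  exact hid x y z hx0 hw (denom_ne_zero hw h₃ hz)


/-! ### The linear decomposition (2.10) and its seven `ϑ`-conjugates, for `Ĩ` -/

/-- **`R0`** ((2.10) itself; needs `lmqr > 0`): the integrand identity `(1−x)(1−z) = 1 − x − (1−x)z` integrated over the three circles.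
[cite: RhinViola2001, §2 (2.10) and §3 p. 278] -/
theorem contourI_R0 (h j k l m q r s : ℕ) {ρ₁ ρ₂ ρ₃ : ℝ} (h₁ : 0 < ρ₁) (h₂ : 0 < ρ₂) (h₃ : 0 < ρ₃) :
    contourI (ofNat h j k (l+1) (m+1) (q+1) (r+1) s) ρ₁ ρ₂ ρ₃
      = contourI (ofNat h j k l m q r s) ρ₁ ρ₂ ρ₃ - contourI (ofNat (h+1) j k l m q (r+1) s) ρ₁ ρ₂ ρ₃
        - contourI (ofNat h (j+1) k (l+1) m q r s) ρ₁ ρ₂ ρ₃ := by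
  refine contourI_rel ⟨_, _, _, _, _, _, _, _, rfl⟩ ⟨_, _, _, _, _, _, _, _, rfl⟩ ⟨_, _, _, _, _, _, _, _, rfl⟩
    ⟨_, _, _, _, _, _, _, _, rfl⟩ h₁ h₂ h₃ fun x y z _ _ hD => ?_
  obtain ⟨E, hE⟩ : ∃ E : ℤ, E = (r:ℤ) - q - h - 1 := ⟨_, rfl⟩
  rw [cI_nf h j k (l+1) (m+1) (q+1) (r+1) s (E) (by omega), cI_nf h j k l m q r s (E) (by omega),
    cI_nf (h+1) j k l m q (r+1) s (E) (by omega), cI_nf h (j+1) k (l+1) m q r s (E) (by omega)]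
  ring

/-- **`R1`** (the ϑ-conjugate of (2.10); needs `mqrs > 0`): the integrand identity `(1−y)(1−z) = 1 − (1−y)z − y` integrated over the three circles.
[cite: RhinViola2001, §2 (2.10) and §3 p. 278] -/
theorem contourI_R1 (h j k l m q r s : ℕ) {ρ₁ ρ₂ ρ₃ : ℝ} (h₁ : 0 < ρ₁) (h₂ : 0 < ρ₂) (h₃ : 0 < ρ₃) :
    contourI (ofNat h j k l (m+1) (q+1) (r+1) (s+1)) ρ₁ ρ₂ ρ₃
      = contourI (ofNat h j k l m q r s) ρ₁ ρ₂ ρ₃ - contourI (ofNat h (j+1) k l m q r (s+1)) ρ₁ ρ₂ ρ₃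
        - contourI (ofNat h j (k+1) l (m+1) q r s) ρ₁ ρ₂ ρ₃ := by
  refine contourI_rel ⟨_, _, _, _, _, _, _, _, rfl⟩ ⟨_, _, _, _, _, _, _, _, rfl⟩ ⟨_, _, _, _, _, _, _, _, rfl⟩
    ⟨_, _, _, _, _, _, _, _, rfl⟩ h₁ h₂ h₃ fun x y z _ _ hD => ?_
  obtain ⟨E, hE⟩ : ∃ E : ℤ, E = (r:ℤ) - q - h - 1 := ⟨_, rfl⟩
  rw [cI_nf h j k l (m+1) (q+1) (r+1) (s+1) (E) (by omega), cI_nf h j k l m q r s (E) (by omega),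
    cI_nf h (j+1) k l m q r (s+1) (E) (by omega), cI_nf h j (k+1) l (m+1) q r s (E) (by omega)]
  ring

/-- **`R2`** (the ϑ²-conjugate of (2.10); needs `qrsh > 0`): the integrand identity `x(1−y)(1−z) = (1−(1−xy)z) − xy − (1−x)(1−z)` integrated over the three circles.
[cite: RhinViola2001, §2 (2.10) and §3 p. 278] -/
theorem contourI_R2 (h j k l m q r s : ℕ) {ρ₁ ρ₂ ρ₃ : ℝ} (h₁ : 0 < ρ₁) (h₂ : 0 < ρ₂) (h₃ : 0 < ρ₃) :
    contourI (ofNat (h+1) j k l m (q+1) (r+1) (s+1)) ρ₁ ρ₂ ρ₃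
      = contourI (ofNat h j k l m q r s) ρ₁ ρ₂ ρ₃ - contourI (ofNat (h+1) j (k+1) l m q r s) ρ₁ ρ₂ ρ₃
        - contourI (ofNat h j k (l+1) m (q+1) r s) ρ₁ ρ₂ ρ₃ := by
  refine contourI_rel ⟨_, _, _, _, _, _, _, _, rfl⟩ ⟨_, _, _, _, _, _, _, _, rfl⟩ ⟨_, _, _, _, _, _, _, _, rfl⟩
    ⟨_, _, _, _, _, _, _, _, rfl⟩ h₁ h₂ h₃ fun x y z _ _ hD => ?_
  obtain ⟨E, hE⟩ : ∃ E : ℤ, E = (r:ℤ) - q - h - 2 := ⟨_, rfl⟩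
  rw [cI_nf (h+1) j k l m (q+1) (r+1) (s+1) (E) (by omega), cI_nf h j k l m q r s (E + 1) (by omega),
    cI_nf (h+1) j (k+1) l m q r s (E) (by omega), cI_nf h j k (l+1) m (q+1) r s (E) (by omega)]
  rw [zpow_add_one₀ hD]
  ring

/-- **`R3`** (the ϑ³-conjugate of (2.10); needs `rshj > 0`): the integrand identity `xz(1−y) = 1 − z(1−x) − (1−(1−xy)z)` integrated over the three circles.
[cite: RhinViola2001, §2 (2.10) and §3 p. 278] -/
theorem contourI_R3 (h j k l m q r s : ℕ) {ρ₁ ρ₂ ρ₃ : ℝ} (h₁ : 0 < ρ₁) (h₂ : 0 < ρ₂) (h₃ : 0 < ρ₃) :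
    contourI (ofNat (h+1) (j+1) k l m q (r+1) (s+1)) ρ₁ ρ₂ ρ₃
      = contourI (ofNat h j k l m q r s) ρ₁ ρ₂ ρ₃ - contourI (ofNat h (j+1) k (l+1) m q r s) ρ₁ ρ₂ ρ₃
        - contourI (ofNat h j k l (m+1) q (r+1) s) ρ₁ ρ₂ ρ₃ := by
  refine contourI_rel ⟨_, _, _, _, _, _, _, _, rfl⟩ ⟨_, _, _, _, _, _, _, _, rfl⟩ ⟨_, _, _, _, _, _, _, _, rfl⟩
    ⟨_, _, _, _, _, _, _, _, rfl⟩ h₁ h₂ h₃ fun x y z _ _ hD => ?_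
  obtain ⟨E, hE⟩ : ∃ E : ℤ, E = (r:ℤ) - q - h - 1 := ⟨_, rfl⟩
  rw [cI_nf (h+1) (j+1) k l m q (r+1) (s+1) (E) (by omega), cI_nf h j k l m q r s (E) (by omega),
    cI_nf h (j+1) k (l+1) m q r s (E) (by omega), cI_nf h j k l (m+1) q (r+1) s (E + 1) (by omega)]
  rw [zpow_add_one₀ hD]
  ring

/-- **`R4`** (the ϑ⁴-conjugate of (2.10); needs `shjk > 0`): the integrand identity `xyz(1−y) = (1−(1−xy)z) − y(1−(1−xy)z) − (1−y)(1−z)` integrated over the three circles.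
[cite: RhinViola2001, §2 (2.10) and §3 p. 278] -/
theorem contourI_R4 (h j k l m q r s : ℕ) {ρ₁ ρ₂ ρ₃ : ℝ} (h₁ : 0 < ρ₁) (h₂ : 0 < ρ₂) (h₃ : 0 < ρ₃) :
    contourI (ofNat (h+1) (j+1) (k+1) l m q r (s+1)) ρ₁ ρ₂ ρ₃
      = contourI (ofNat h j k l m q r s) ρ₁ ρ₂ ρ₃ - contourI (ofNat h j (k+1) l (m+1) q r s) ρ₁ ρ₂ ρ₃
        - contourI (ofNat h j k l m (q+1) r (s+1)) ρ₁ ρ₂ ρ₃ := by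
  refine contourI_rel ⟨_, _, _, _, _, _, _, _, rfl⟩ ⟨_, _, _, _, _, _, _, _, rfl⟩ ⟨_, _, _, _, _, _, _, _, rfl⟩
    ⟨_, _, _, _, _, _, _, _, rfl⟩ h₁ h₂ h₃ fun x y z _ _ hD => ?_
  obtain ⟨E, hE⟩ : ∃ E : ℤ, E = (r:ℤ) - q - h - 2 := ⟨_, rfl⟩
  rw [cI_nf (h+1) (j+1) (k+1) l m q r (s+1) (E) (by omega), cI_nf h j k l m q r s (E + 1) (by omega),
    cI_nf h j (k+1) l (m+1) q r s (E + 1) (by omega), cI_nf h j k l m (q+1) r (s+1) (E) (by omega)]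
  rw [zpow_add_one₀ hD]
  ring

/-- **`R5`** (the ϑ⁵-conjugate of (2.10); needs `hjkl > 0`): the integrand identity `xyz(1−x) = (1−(1−xy)z) − (1−x)(1−z) − x(1−(1−xy)z)` integrated over the three circles.
[cite: RhinViola2001, §2 (2.10) and §3 p. 278] -/
theorem contourI_R5 (h j k l m q r s : ℕ) {ρ₁ ρ₂ ρ₃ : ℝ} (h₁ : 0 < ρ₁) (h₂ : 0 < ρ₂) (h₃ : 0 < ρ₃) :
    contourI (ofNat (h+1) (j+1) (k+1) (l+1) m q r s) ρ₁ ρ₂ ρ₃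
      = contourI (ofNat h j k l m q r s) ρ₁ ρ₂ ρ₃ - contourI (ofNat h j k (l+1) m (q+1) r s) ρ₁ ρ₂ ρ₃
        - contourI (ofNat (h+1) j k l m q (r+1) s) ρ₁ ρ₂ ρ₃ := by
  refine contourI_rel ⟨_, _, _, _, _, _, _, _, rfl⟩ ⟨_, _, _, _, _, _, _, _, rfl⟩ ⟨_, _, _, _, _, _, _, _, rfl⟩
    ⟨_, _, _, _, _, _, _, _, rfl⟩ h₁ h₂ h₃ fun x y z _ _ hD => ?_
  obtain ⟨E, hE⟩ : ∃ E : ℤ, E = (r:ℤ) - q - h - 2 := ⟨_, rfl⟩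
  rw [cI_nf (h+1) (j+1) (k+1) (l+1) m q r s (E) (by omega), cI_nf h j k l m q r s (E + 1) (by omega),
    cI_nf h j k (l+1) m (q+1) r s (E) (by omega), cI_nf (h+1) j k l m q (r+1) s (E + 1) (by omega)]
  rw [zpow_add_one₀ hD]
  ring

/-- **`R6`** (the ϑ⁶-conjugate of (2.10); needs `jklm > 0`): the integrand identity `yz(1−x) = 1 − (1−(1−xy)z) − z(1−y)` integrated over the three circles.
[cite: RhinViola2001, §2 (2.10) and §3 p. 278] -/
theorem contourI_R6 (h j k l m q r s : ℕ) {ρ₁ ρ₂ ρ₃ : ℝ} (h₁ : 0 < ρ₁) (h₂ : 0 < ρ₂) (h₃ : 0 < ρ₃) :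
    contourI (ofNat h (j+1) (k+1) (l+1) (m+1) q r s) ρ₁ ρ₂ ρ₃
      = contourI (ofNat h j k l m q r s) ρ₁ ρ₂ ρ₃ - contourI (ofNat h j k l (m+1) q (r+1) s) ρ₁ ρ₂ ρ₃
        - contourI (ofNat h (j+1) k l m q r (s+1)) ρ₁ ρ₂ ρ₃ := by
  refine contourI_rel ⟨_, _, _, _, _, _, _, _, rfl⟩ ⟨_, _, _, _, _, _, _, _, rfl⟩ ⟨_, _, _, _, _, _, _, _, rfl⟩
    ⟨_, _, _, _, _, _, _, _, rfl⟩ h₁ h₂ h₃ fun x y z _ _ hD => ?_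
  obtain ⟨E, hE⟩ : ∃ E : ℤ, E = (r:ℤ) - q - h - 1 := ⟨_, rfl⟩
  rw [cI_nf h (j+1) (k+1) (l+1) (m+1) q r s (E) (by omega), cI_nf h j k l m q r s (E) (by omega),
    cI_nf h j k l (m+1) q (r+1) s (E + 1) (by omega), cI_nf h (j+1) k l m q r (s+1) (E) (by omega)]
  rw [zpow_add_one₀ hD]
  ring

/-- **`R7`** (the ϑ⁷-conjugate of (2.10); needs `klmq > 0`): the integrand identity `y(1−x)(1−z) = (1−(1−xy)z) − (1−y)(1−z) − xy` integrated over the three circles.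
[cite: RhinViola2001, §2 (2.10) and §3 p. 278] -/
theorem contourI_R7 (h j k l m q r s : ℕ) {ρ₁ ρ₂ ρ₃ : ℝ} (h₁ : 0 < ρ₁) (h₂ : 0 < ρ₂) (h₃ : 0 < ρ₃) :
    contourI (ofNat h j (k+1) (l+1) (m+1) (q+1) r s) ρ₁ ρ₂ ρ₃
      = contourI (ofNat h j k l m q r s) ρ₁ ρ₂ ρ₃ - contourI (ofNat h j k l m (q+1) r (s+1)) ρ₁ ρ₂ ρ₃
        - contourI (ofNat (h+1) j (k+1) l m q r s) ρ₁ ρ₂ ρ₃ := by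
  refine contourI_rel ⟨_, _, _, _, _, _, _, _, rfl⟩ ⟨_, _, _, _, _, _, _, _, rfl⟩ ⟨_, _, _, _, _, _, _, _, rfl⟩
    ⟨_, _, _, _, _, _, _, _, rfl⟩ h₁ h₂ h₃ fun x y z _ _ hD => ?_
  obtain ⟨E, hE⟩ : ∃ E : ℤ, E = (r:ℤ) - q - h - 2 := ⟨_, rfl⟩
  rw [cI_nf h j (k+1) (l+1) (m+1) (q+1) r s (E) (by omega), cI_nf h j k l m q r s (E + 1) (by omega),
    cI_nf h j k l m (q+1) r (s+1) (E) (by omega), cI_nf (h+1) j (k+1) l m q r s (E) (by omega)]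
  rw [zpow_add_one₀ hD]
  ring


/-! ### The same eight decompositions for `I` (tree: `Theorem21.I_decomp` transported along `Theorem21.I_rot`) -/

/-- `ϑ^0` unfolded (plumbing). [folklore] -/
private theorem rot0 (P : Params) : rot 0 P = P := rfl
/-- `ϑ^1` unfolded (plumbing). [folklore] -/
private theorem rot1 (P : Params) : rot 1 P = theta P := rfl
/-- `ϑ^2` unfolded (plumbing). [folklore] -/
private theorem rot2 (P : Params) : rot 2 P = theta (theta P) := rfl
/-- `ϑ^3` unfolded (plumbing). [folklore] -/
private theorem rot3 (P : Params) : rot 3 P = theta (theta (theta P)) := rfl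
/-- `ϑ^4` unfolded (plumbing). [folklore] -/
private theorem rot4 (P : Params) : rot 4 P = theta (theta (theta (theta P))) := rfl
/-- `ϑ^5` unfolded (plumbing). [folklore] -/
private theorem rot5 (P : Params) : rot 5 P = theta (theta (theta (theta (theta P)))) := rfl
/-- `ϑ^6` unfolded (plumbing). [folklore] -/
private theorem rot6 (P : Params) : rot 6 P = theta (theta (theta (theta (theta (theta P))))) := rfl
/-- `ϑ^7` unfolded (plumbing). [folklore] -/
private theorem rot7 (P : Params) : rot 7 P = theta (theta (theta (theta (theta (theta (theta P)))))) := rfl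

/-- `ofNat` tuples: (2.2)–(2.3) of the children from that of the parent (plumbing). [folklore] -/
private theorem balanced_ofNat_iff (h j k l m q r s : ℕ) :
    (ofNat h j k l m q r s).Balanced ↔ h + m = k + r ∧ j + q = l + s := by
  simp only [Params.Balanced, ofNat]; omega

/-- **`R0` for `I`**: `I(P) = I(ϑ^0P)` (invariance), (2.10) for `ϑ^0P` (tree `I_decomp`), and back.
[cite: RhinViola2001, §2 (2.10), p. 272 and p. 275] -/
theorem I_R0 (h j k l m q r s : ℕ) (hB : (ofNat h j k (l+1) (m+1) (q+1) (r+1) s).Balanced) :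
    I (ofNat h j k (l+1) (m+1) (q+1) (r+1) s) = I (ofNat h j k l m q r s) - I (ofNat (h+1) j k l m q (r+1) s) - I (ofNat h (j+1) k (l+1) m q r s) := by
  have hB' := (balanced_ofNat_iff _ _ _ _ _ _ _ _).mp hB
  have hBA : (ofNat h j k l m q r s).Balanced := (balanced_ofNat_iff _ _ _ _ _ _ _ _).mpr (by omega)
  have hBB : (ofNat (h+1) j k l m q (r+1) s).Balanced := (balanced_ofNat_iff _ _ _ _ _ _ _ _).mpr (by omega)
  have hBC : (ofNat h (j+1) k (l+1) m q r s).Balanced := (balanced_ofNat_iff _ _ _ _ _ _ _ _).mpr (by omega)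
  rw [← I_rot (ofNat h j k (l+1) (m+1) (q+1) (r+1) s) hB 0,
    I_decomp (nonneg_rot (nonneg_ofNat _ _ _ _ _ _ _ _) 0) (balanced_rot hB 0)
      (by simp only [rot0, ofNat]; omega) (by simp only [rot0, ofNat]; omega)
      (by simp only [rot0, ofNat]; omega) (by simp only [rot0, ofNat]; omega),
    show childA (rot 0 (ofNat h j k (l+1) (m+1) (q+1) (r+1) s)) = rot 0 (ofNat h j k l m q r s) by
      ext <;> simp only [rot0, childA, ofNat] <;> omega,
    show childB (rot 0 (ofNat h j k (l+1) (m+1) (q+1) (r+1) s)) = rot 0 (ofNat (h+1) j k l m q (r+1) s) by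
      ext <;> simp only [rot0, childB, ofNat] <;> omega,
    show childC (rot 0 (ofNat h j k (l+1) (m+1) (q+1) (r+1) s)) = rot 0 (ofNat h (j+1) k (l+1) m q r s) by
      ext <;> simp only [rot0, childC, ofNat] <;> omega,
    I_rot _ hBA 0, I_rot _ hBB 0, I_rot _ hBC 0]

/-- **`R1` for `I`**: `I(P) = I(ϑ^1P)` (invariance), (2.10) for `ϑ^1P` (tree `I_decomp`), and back.
[cite: RhinViola2001, §2 (2.10), p. 272 and p. 275] -/
theorem I_R1 (h j k l m q r s : ℕ) (hB : (ofNat h j k l (m+1) (q+1) (r+1) (s+1)).Balanced) :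
    I (ofNat h j k l (m+1) (q+1) (r+1) (s+1)) = I (ofNat h j k l m q r s) - I (ofNat h (j+1) k l m q r (s+1)) - I (ofNat h j (k+1) l (m+1) q r s) := by
  have hB' := (balanced_ofNat_iff _ _ _ _ _ _ _ _).mp hB
  have hBA : (ofNat h j k l m q r s).Balanced := (balanced_ofNat_iff _ _ _ _ _ _ _ _).mpr (by omega)
  have hBB : (ofNat h (j+1) k l m q r (s+1)).Balanced := (balanced_ofNat_iff _ _ _ _ _ _ _ _).mpr (by omega)
  have hBC : (ofNat h j (k+1) l (m+1) q r s).Balanced := (balanced_ofNat_iff _ _ _ _ _ _ _ _).mpr (by omega)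
  rw [← I_rot (ofNat h j k l (m+1) (q+1) (r+1) (s+1)) hB 1,
    I_decomp (nonneg_rot (nonneg_ofNat _ _ _ _ _ _ _ _) 1) (balanced_rot hB 1)
      (by simp only [rot1, theta, ofNat]; omega) (by simp only [rot1, theta, ofNat]; omega)
      (by simp only [rot1, theta, ofNat]; omega) (by simp only [rot1, theta, ofNat]; omega),
    show childA (rot 1 (ofNat h j k l (m+1) (q+1) (r+1) (s+1))) = rot 1 (ofNat h j k l m q r s) by
      ext <;> simp only [rot1, theta, childA, ofNat] <;> omega,
    show childB (rot 1 (ofNat h j k l (m+1) (q+1) (r+1) (s+1))) = rot 1 (ofNat h (j+1) k l m q r (s+1)) by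
      ext <;> simp only [rot1, theta, childB, ofNat] <;> omega,
    show childC (rot 1 (ofNat h j k l (m+1) (q+1) (r+1) (s+1))) = rot 1 (ofNat h j (k+1) l (m+1) q r s) by
      ext <;> simp only [rot1, theta, childC, ofNat] <;> omega,
    I_rot _ hBA 1, I_rot _ hBB 1, I_rot _ hBC 1]

/-- **`R2` for `I`**: `I(P) = I(ϑ^2P)` (invariance), (2.10) for `ϑ^2P` (tree `I_decomp`), and back.
[cite: RhinViola2001, §2 (2.10), p. 272 and p. 275] -/
theorem I_R2 (h j k l m q r s : ℕ) (hB : (ofNat (h+1) j k l m (q+1) (r+1) (s+1)).Balanced) :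
    I (ofNat (h+1) j k l m (q+1) (r+1) (s+1)) = I (ofNat h j k l m q r s) - I (ofNat (h+1) j (k+1) l m q r s) - I (ofNat h j k (l+1) m (q+1) r s) := by
  have hB' := (balanced_ofNat_iff _ _ _ _ _ _ _ _).mp hB
  have hBA : (ofNat h j k l m q r s).Balanced := (balanced_ofNat_iff _ _ _ _ _ _ _ _).mpr (by omega)
  have hBB : (ofNat (h+1) j (k+1) l m q r s).Balanced := (balanced_ofNat_iff _ _ _ _ _ _ _ _).mpr (by omega)
  have hBC : (ofNat h j k (l+1) m (q+1) r s).Balanced := (balanced_ofNat_iff _ _ _ _ _ _ _ _).mpr (by omega)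
  rw [← I_rot (ofNat (h+1) j k l m (q+1) (r+1) (s+1)) hB 2,
    I_decomp (nonneg_rot (nonneg_ofNat _ _ _ _ _ _ _ _) 2) (balanced_rot hB 2)
      (by simp only [rot2, theta, ofNat]; omega) (by simp only [rot2, theta, ofNat]; omega)
      (by simp only [rot2, theta, ofNat]; omega) (by simp only [rot2, theta, ofNat]; omega),
    show childA (rot 2 (ofNat (h+1) j k l m (q+1) (r+1) (s+1))) = rot 2 (ofNat h j k l m q r s) by
      ext <;> simp only [rot2, theta, childA, ofNat] <;> omega,
    show childB (rot 2 (ofNat (h+1) j k l m (q+1) (r+1) (s+1))) = rot 2 (ofNat (h+1) j (k+1) l m q r s) by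
      ext <;> simp only [rot2, theta, childB, ofNat] <;> omega,
    show childC (rot 2 (ofNat (h+1) j k l m (q+1) (r+1) (s+1))) = rot 2 (ofNat h j k (l+1) m (q+1) r s) by
      ext <;> simp only [rot2, theta, childC, ofNat] <;> omega,
    I_rot _ hBA 2, I_rot _ hBB 2, I_rot _ hBC 2]

/-- **`R3` for `I`**: `I(P) = I(ϑ^3P)` (invariance), (2.10) for `ϑ^3P` (tree `I_decomp`), and back.
[cite: RhinViola2001, §2 (2.10), p. 272 and p. 275] -/
theorem I_R3 (h j k l m q r s : ℕ) (hB : (ofNat (h+1) (j+1) k l m q (r+1) (s+1)).Balanced) :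
    I (ofNat (h+1) (j+1) k l m q (r+1) (s+1)) = I (ofNat h j k l m q r s) - I (ofNat h (j+1) k (l+1) m q r s) - I (ofNat h j k l (m+1) q (r+1) s) := by
  have hB' := (balanced_ofNat_iff _ _ _ _ _ _ _ _).mp hB
  have hBA : (ofNat h j k l m q r s).Balanced := (balanced_ofNat_iff _ _ _ _ _ _ _ _).mpr (by omega)
  have hBB : (ofNat h (j+1) k (l+1) m q r s).Balanced := (balanced_ofNat_iff _ _ _ _ _ _ _ _).mpr (by omega)
  have hBC : (ofNat h j k l (m+1) q (r+1) s).Balanced := (balanced_ofNat_iff _ _ _ _ _ _ _ _).mpr (by omega)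
  rw [← I_rot (ofNat (h+1) (j+1) k l m q (r+1) (s+1)) hB 3,
    I_decomp (nonneg_rot (nonneg_ofNat _ _ _ _ _ _ _ _) 3) (balanced_rot hB 3)
      (by simp only [rot3, theta, ofNat]; omega) (by simp only [rot3, theta, ofNat]; omega)
      (by simp only [rot3, theta, ofNat]; omega) (by simp only [rot3, theta, ofNat]; omega),
    show childA (rot 3 (ofNat (h+1) (j+1) k l m q (r+1) (s+1))) = rot 3 (ofNat h j k l m q r s) by
      ext <;> simp only [rot3, theta, childA, ofNat] <;> omega,
    show childB (rot 3 (ofNat (h+1) (j+1) k l m q (r+1) (s+1))) = rot 3 (ofNat h (j+1) k (l+1) m q r s) by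
      ext <;> simp only [rot3, theta, childB, ofNat] <;> omega,
    show childC (rot 3 (ofNat (h+1) (j+1) k l m q (r+1) (s+1))) = rot 3 (ofNat h j k l (m+1) q (r+1) s) by
      ext <;> simp only [rot3, theta, childC, ofNat] <;> omega,
    I_rot _ hBA 3, I_rot _ hBB 3, I_rot _ hBC 3]

/-- **`R4` for `I`**: `I(P) = I(ϑ^4P)` (invariance), (2.10) for `ϑ^4P` (tree `I_decomp`), and back.
[cite: RhinViola2001, §2 (2.10), p. 272 and p. 275] -/
theorem I_R4 (h j k l m q r s : ℕ) (hB : (ofNat (h+1) (j+1) (k+1) l m q r (s+1)).Balanced) :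
    I (ofNat (h+1) (j+1) (k+1) l m q r (s+1)) = I (ofNat h j k l m q r s) - I (ofNat h j (k+1) l (m+1) q r s) - I (ofNat h j k l m (q+1) r (s+1)) := by
  have hB' := (balanced_ofNat_iff _ _ _ _ _ _ _ _).mp hB
  have hBA : (ofNat h j k l m q r s).Balanced := (balanced_ofNat_iff _ _ _ _ _ _ _ _).mpr (by omega)
  have hBB : (ofNat h j (k+1) l (m+1) q r s).Balanced := (balanced_ofNat_iff _ _ _ _ _ _ _ _).mpr (by omega)
  have hBC : (ofNat h j k l m (q+1) r (s+1)).Balanced := (balanced_ofNat_iff _ _ _ _ _ _ _ _).mpr (by omega)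
  rw [← I_rot (ofNat (h+1) (j+1) (k+1) l m q r (s+1)) hB 4,
    I_decomp (nonneg_rot (nonneg_ofNat _ _ _ _ _ _ _ _) 4) (balanced_rot hB 4)
      (by simp only [rot4, theta, ofNat]; omega) (by simp only [rot4, theta, ofNat]; omega)
      (by simp only [rot4, theta, ofNat]; omega) (by simp only [rot4, theta, ofNat]; omega),
    show childA (rot 4 (ofNat (h+1) (j+1) (k+1) l m q r (s+1))) = rot 4 (ofNat h j k l m q r s) by
      ext <;> simp only [rot4, theta, childA, ofNat] <;> omega,
    show childB (rot 4 (ofNat (h+1) (j+1) (k+1) l m q r (s+1))) = rot 4 (ofNat h j (k+1) l (m+1) q r s) by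
      ext <;> simp only [rot4, theta, childB, ofNat] <;> omega,
    show childC (rot 4 (ofNat (h+1) (j+1) (k+1) l m q r (s+1))) = rot 4 (ofNat h j k l m (q+1) r (s+1)) by
      ext <;> simp only [rot4, theta, childC, ofNat] <;> omega,
    I_rot _ hBA 4, I_rot _ hBB 4, I_rot _ hBC 4]

/-- **`R5` for `I`**: `I(P) = I(ϑ^5P)` (invariance), (2.10) for `ϑ^5P` (tree `I_decomp`), and back.
[cite: RhinViola2001, §2 (2.10), p. 272 and p. 275] -/
theorem I_R5 (h j k l m q r s : ℕ) (hB : (ofNat (h+1) (j+1) (k+1) (l+1) m q r s).Balanced) :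
    I (ofNat (h+1) (j+1) (k+1) (l+1) m q r s) = I (ofNat h j k l m q r s) - I (ofNat h j k (l+1) m (q+1) r s) - I (ofNat (h+1) j k l m q (r+1) s) := by
  have hB' := (balanced_ofNat_iff _ _ _ _ _ _ _ _).mp hB
  have hBA : (ofNat h j k l m q r s).Balanced := (balanced_ofNat_iff _ _ _ _ _ _ _ _).mpr (by omega)
  have hBB : (ofNat h j k (l+1) m (q+1) r s).Balanced := (balanced_ofNat_iff _ _ _ _ _ _ _ _).mpr (by omega)
  have hBC : (ofNat (h+1) j k l m q (r+1) s).Balanced := (balanced_ofNat_iff _ _ _ _ _ _ _ _).mpr (by omega)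
  rw [← I_rot (ofNat (h+1) (j+1) (k+1) (l+1) m q r s) hB 5,
    I_decomp (nonneg_rot (nonneg_ofNat _ _ _ _ _ _ _ _) 5) (balanced_rot hB 5)
      (by simp only [rot5, theta, ofNat]; omega) (by simp only [rot5, theta, ofNat]; omega)
      (by simp only [rot5, theta, ofNat]; omega) (by simp only [rot5, theta, ofNat]; omega),
    show childA (rot 5 (ofNat (h+1) (j+1) (k+1) (l+1) m q r s)) = rot 5 (ofNat h j k l m q r s) by
      ext <;> simp only [rot5, theta, childA, ofNat] <;> omega,
    show childB (rot 5 (ofNat (h+1) (j+1) (k+1) (l+1) m q r s)) = rot 5 (ofNat h j k (l+1) m (q+1) r s) by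
      ext <;> simp only [rot5, theta, childB, ofNat] <;> omega,
    show childC (rot 5 (ofNat (h+1) (j+1) (k+1) (l+1) m q r s)) = rot 5 (ofNat (h+1) j k l m q (r+1) s) by
      ext <;> simp only [rot5, theta, childC, ofNat] <;> omega,
    I_rot _ hBA 5, I_rot _ hBB 5, I_rot _ hBC 5]

/-- **`R6` for `I`**: `I(P) = I(ϑ^6P)` (invariance), (2.10) for `ϑ^6P` (tree `I_decomp`), and back.
[cite: RhinViola2001, §2 (2.10), p. 272 and p. 275] -/
theorem I_R6 (h j k l m q r s : ℕ) (hB : (ofNat h (j+1) (k+1) (l+1) (m+1) q r s).Balanced) :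
    I (ofNat h (j+1) (k+1) (l+1) (m+1) q r s) = I (ofNat h j k l m q r s) - I (ofNat h j k l (m+1) q (r+1) s) - I (ofNat h (j+1) k l m q r (s+1)) := by
  have hB' := (balanced_ofNat_iff _ _ _ _ _ _ _ _).mp hB
  have hBA : (ofNat h j k l m q r s).Balanced := (balanced_ofNat_iff _ _ _ _ _ _ _ _).mpr (by omega)
  have hBB : (ofNat h j k l (m+1) q (r+1) s).Balanced := (balanced_ofNat_iff _ _ _ _ _ _ _ _).mpr (by omega)
  have hBC : (ofNat h (j+1) k l m q r (s+1)).Balanced := (balanced_ofNat_iff _ _ _ _ _ _ _ _).mpr (by omega)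
  rw [← I_rot (ofNat h (j+1) (k+1) (l+1) (m+1) q r s) hB 6,
    I_decomp (nonneg_rot (nonneg_ofNat _ _ _ _ _ _ _ _) 6) (balanced_rot hB 6)
      (by simp only [rot6, theta, ofNat]; omega) (by simp only [rot6, theta, ofNat]; omega)
      (by simp only [rot6, theta, ofNat]; omega) (by simp only [rot6, theta, ofNat]; omega),
    show childA (rot 6 (ofNat h (j+1) (k+1) (l+1) (m+1) q r s)) = rot 6 (ofNat h j k l m q r s) by
      ext <;> simp only [rot6, theta, childA, ofNat] <;> omega,
    show childB (rot 6 (ofNat h (j+1) (k+1) (l+1) (m+1) q r s)) = rot 6 (ofNat h j k l (m+1) q (r+1) s) by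
      ext <;> simp only [rot6, theta, childB, ofNat] <;> omega,
    show childC (rot 6 (ofNat h (j+1) (k+1) (l+1) (m+1) q r s)) = rot 6 (ofNat h (j+1) k l m q r (s+1)) by
      ext <;> simp only [rot6, theta, childC, ofNat] <;> omega,
    I_rot _ hBA 6, I_rot _ hBB 6, I_rot _ hBC 6]

/-- **`R7` for `I`**: `I(P) = I(ϑ^7P)` (invariance), (2.10) for `ϑ^7P` (tree `I_decomp`), and back.
[cite: RhinViola2001, §2 (2.10), p. 272 and p. 275] -/
theorem I_R7 (h j k l m q r s : ℕ) (hB : (ofNat h j (k+1) (l+1) (m+1) (q+1) r s).Balanced) :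
    I (ofNat h j (k+1) (l+1) (m+1) (q+1) r s) = I (ofNat h j k l m q r s) - I (ofNat h j k l m (q+1) r (s+1)) - I (ofNat (h+1) j (k+1) l m q r s) := by
  have hB' := (balanced_ofNat_iff _ _ _ _ _ _ _ _).mp hB
  have hBA : (ofNat h j k l m q r s).Balanced := (balanced_ofNat_iff _ _ _ _ _ _ _ _).mpr (by omega)
  have hBB : (ofNat h j k l m (q+1) r (s+1)).Balanced := (balanced_ofNat_iff _ _ _ _ _ _ _ _).mpr (by omega)
  have hBC : (ofNat (h+1) j (k+1) l m q r s).Balanced := (balanced_ofNat_iff _ _ _ _ _ _ _ _).mpr (by omega)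
  rw [← I_rot (ofNat h j (k+1) (l+1) (m+1) (q+1) r s) hB 7,
    I_decomp (nonneg_rot (nonneg_ofNat _ _ _ _ _ _ _ _) 7) (balanced_rot hB 7)
      (by simp only [rot7, theta, ofNat]; omega) (by simp only [rot7, theta, ofNat]; omega)
      (by simp only [rot7, theta, ofNat]; omega) (by simp only [rot7, theta, ofNat]; omega),
    show childA (rot 7 (ofNat h j (k+1) (l+1) (m+1) (q+1) r s)) = rot 7 (ofNat h j k l m q r s) by
      ext <;> simp only [rot7, theta, childA, ofNat] <;> omega,
    show childB (rot 7 (ofNat h j (k+1) (l+1) (m+1) (q+1) r s)) = rot 7 (ofNat h j k l m (q+1) r (s+1)) by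
      ext <;> simp only [rot7, theta, childB, ofNat] <;> omega,
    show childC (rot 7 (ofNat h j (k+1) (l+1) (m+1) (q+1) r s)) = rot 7 (ofNat (h+1) j (k+1) l m q r s) by
      ext <;> simp only [rot7, theta, childC, ofNat] <;> omega,
    I_rot _ hBA 7, I_rot _ hBB 7, I_rot _ hBC 7]

/-! ### "`I` … of the preceding type": rationality when the least of (2.8) is negative -/

/-- The polynomial case: "If `q + h − r < 0`, then `I` is the integral of a polynomial … `d_{r+l−q} d_{m+s−q} d_{j+r−h} I ∈ ℤ`"
— in particular `I ∈ ℚ` (tree `Theorem21.exists_int_of_lt`). [cite: RhinViola2001, §2 p. 274] -/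
theorem rational_of_lt {P : Params} (hN : P.Nonneg) (hB : P.Balanced) (hlt : P.q + P.h - P.r < 0) :
    ∃ a : ℚ, I P = a := by
  obtain ⟨A, hA⟩ := exists_int_of_lt hN hB hlt
  have hne0 : d P.aux.r * d P.aux.m * d P.aux.j ≠ 0 := by
    unfold d
    exact mul_ne_zero (mul_ne_zero (Nat.lcmUpto_ne_zero _) (Nat.lcmUpto_ne_zero _)) (Nat.lcmUpto_ne_zero _)
  have hne : ((d P.aux.r * d P.aux.m * d P.aux.j : ℕ) : ℝ) ≠ 0 := by exact_mod_cast hne0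
  refine ⟨(A : ℚ) / (d P.aux.r * d P.aux.m * d P.aux.j : ℕ), ?_⟩
  push_cast
  rw [eq_div_iff (by exact_mod_cast hne0)]
  rw [mul_comm] at hA
  exact_mod_cast hA

/-- "If `q + h − r ≥ 0` but the least of the integers (2.8) is `< 0`, then `I` is changed by a suitable power of the
permutation `ϑ` into an integral of the preceding type" — so `I ∈ ℚ`. [cite: RhinViola2001, §2 p. 274] -/
theorem rational_of_aux_neg {P : Params} (hN : P.Nonneg) (hB : P.Balanced) (hneg : ∃ x ∈ P.S, x < 0) :
    ∃ a : ℚ, I P = a := by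
  have hrot : ∀ i, (rot i P).q + (rot i P).h - (rot i P).r < 0 → ∃ a : ℚ, I P = a := by
    intro i hlt
    obtain ⟨a, ha⟩ := rational_of_lt (nonneg_rot hN i) (balanced_rot hB i) hlt
    exact ⟨a, by rw [← I_rot P hB i, ha]⟩
  obtain ⟨x, hx, hx0⟩ := hneg
  simp only [Params.S, Params.toList, List.mem_cons, List.not_mem_nil, or_false] at hx
  simp only [Params.aux] at hx
  rcases hx with rfl | rfl | rfl | rfl | rfl | rfl | rfl | rfl
  · exact hrot 3 (by simp only [rot3, theta]; omega)
  · exact hrot 4 (by simp only [rot4, theta]; omega)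
  · exact hrot 5 (by simp only [rot5, theta]; omega)
  · exact hrot 6 (by simp only [rot6, theta]; omega)
  · exact hrot 7 (by simp only [rot7, theta]; omega)
  · exact hrot 0 (by simp only [rot0]; omega)
  · exact hrot 1 (by simp only [rot1, theta]; omega)
  · exact hrot 2 (by simp only [rot2, theta]; omega)

/-! ### The terminal parameters (p. 275): `(t,0,t,0,t,0,t,0)` and `(0,t,0,t,0,t,0,t)` -/

/-- The printed case analysis with `j = 0`: "First case: `j = q = 0` … `h = k = m = r`", "Second case: `j = 0`,
`q > 0` … [every branch ends in] the least of (2.8) is `< 0`" — so, all of (2.8) being `≥ 0`, the parameters are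
`(h,0,h,0,h,0,h,0)`. [cite: RhinViola2001, §2 p. 275] -/
theorem terminal_j0 {P : Params} (hN : P.Nonneg) (hB : P.Balanced) (haux : P.aux.Nonneg) (hj : P.j = 0)
    (w0 : ¬(0 < P.l ∧ 0 < P.m ∧ 0 < P.q ∧ 0 < P.r)) (w1 : ¬(0 < P.m ∧ 0 < P.q ∧ 0 < P.r ∧ 0 < P.s))
    (w2 : ¬(0 < P.q ∧ 0 < P.r ∧ 0 < P.s ∧ 0 < P.h)) (w7 : ¬(0 < P.k ∧ 0 < P.l ∧ 0 < P.m ∧ 0 < P.q)) :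
    P.l = 0 ∧ P.q = 0 ∧ P.s = 0 ∧ P.k = P.h ∧ P.m = P.h ∧ P.r = P.h := by
  obtain ⟨h0, h1, h2, h3, h4, h5, h6, h7⟩ := hN
  obtain ⟨a0, a1, a2, a3, a4, a5, a6, a7⟩ := haux
  obtain ⟨b1, b2⟩ := hB
  simp only [Params.aux] at a0 a1 a2 a3 a4 a5 a6 a7
  omega

/-- **The terminal parameter sets.** If all of (2.8) are `≥ 0` and `lmqr = mqrs = qrsh = rshj = shjk = hjkl = jklm =
klmq = 0`, then ("up to applying a suitable power of `ϑ`") the parameters are `(t,0,t,0,t,0,t,0)` or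
`(0,t,0,t,0,t,0,t)`. [cite: RhinViola2001, §2 p. 275] -/
theorem terminal_cases {P : Params} (hN : P.Nonneg) (hB : P.Balanced) (haux : P.aux.Nonneg)
    (w0 : ¬(0 < P.l ∧ 0 < P.m ∧ 0 < P.q ∧ 0 < P.r)) (w1 : ¬(0 < P.m ∧ 0 < P.q ∧ 0 < P.r ∧ 0 < P.s))
    (w2 : ¬(0 < P.q ∧ 0 < P.r ∧ 0 < P.s ∧ 0 < P.h)) (w3 : ¬(0 < P.r ∧ 0 < P.s ∧ 0 < P.h ∧ 0 < P.j))
    (w4 : ¬(0 < P.s ∧ 0 < P.h ∧ 0 < P.j ∧ 0 < P.k)) (w5 : ¬(0 < P.h ∧ 0 < P.j ∧ 0 < P.k ∧ 0 < P.l))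
    (w6 : ¬(0 < P.j ∧ 0 < P.k ∧ 0 < P.l ∧ 0 < P.m)) (w7 : ¬(0 < P.k ∧ 0 < P.l ∧ 0 < P.m ∧ 0 < P.q)) :
    ∃ t : ℕ, P = baseP t ∨ P = theta (baseP t) := by
  have hN' := hN
  obtain ⟨h0, h1, h2, h3, h4, h5, h6, h7⟩ := hN'
  have hzero : P.j = 0 ∨ P.k = 0 ∨ P.l = 0 ∨ P.m = 0 ∨ P.q = 0 ∨ P.r = 0 ∨ P.s = 0 ∨ P.h = 0 := by omega
  have T : ∀ i, (rot i P).j = 0 →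
      ¬(0 < (rot i P).l ∧ 0 < (rot i P).m ∧ 0 < (rot i P).q ∧ 0 < (rot i P).r) →
      ¬(0 < (rot i P).m ∧ 0 < (rot i P).q ∧ 0 < (rot i P).r ∧ 0 < (rot i P).s) →
      ¬(0 < (rot i P).q ∧ 0 < (rot i P).r ∧ 0 < (rot i P).s ∧ 0 < (rot i P).h) →
      ¬(0 < (rot i P).k ∧ 0 < (rot i P).l ∧ 0 < (rot i P).m ∧ 0 < (rot i P).q) →
      (rot i P).l = 0 ∧ (rot i P).q = 0 ∧ (rot i P).s = 0 ∧ (rot i P).k = (rot i P).h ∧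
        (rot i P).m = (rot i P).h ∧ (rot i P).r = (rot i P).h :=
    fun i => terminal_j0 (nonneg_rot hN i) (balanced_rot hB i) (auxNonneg_rot haux i)
  rcases hzero with hz | hz | hz | hz | hz | hz | hz | hz
  · have := T 0 (by simpa only [rot0] using hz) (by simpa only [rot0] using w0) (by simpa only [rot0] using w1)
      (by simpa only [rot0] using w2) (by simpa only [rot0] using w7)
    simp only [rot0] at this
    exact ⟨P.h.toNat, Or.inl (by ext <;> simp only [baseP] <;> omega)⟩
  · have := T 1 (by simpa only [rot1, theta] using hz) (by simpa only [rot1, theta] using w1)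
      (by simpa only [rot1, theta] using w2) (by simpa only [rot1, theta] using w3)
      (by simpa only [rot1, theta] using w0)
    simp only [rot1, theta] at this
    exact ⟨P.j.toNat, Or.inr (by ext <;> simp only [baseP, theta] <;> omega)⟩
  · have := T 2 (by simpa only [rot2, theta] using hz) (by simpa only [rot2, theta] using w2)
      (by simpa only [rot2, theta] using w3) (by simpa only [rot2, theta] using w4)
      (by simpa only [rot2, theta] using w1)
    simp only [rot2, theta] at this
    exact ⟨P.h.toNat, Or.inl (by ext <;> simp only [baseP] <;> omega)⟩
  · have := T 3 (by simpa only [rot3, theta] using hz) (by simpa only [rot3, theta] using w3)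
      (by simpa only [rot3, theta] using w4) (by simpa only [rot3, theta] using w5)
      (by simpa only [rot3, theta] using w2)
    simp only [rot3, theta] at this
    exact ⟨P.j.toNat, Or.inr (by ext <;> simp only [baseP, theta] <;> omega)⟩
  · have := T 4 (by simpa only [rot4, theta] using hz) (by simpa only [rot4, theta] using w4)
      (by simpa only [rot4, theta] using w5) (by simpa only [rot4, theta] using w6)
      (by simpa only [rot4, theta] using w3)
    simp only [rot4, theta] at this
    exact ⟨P.h.toNat, Or.inl (by ext <;> simp only [baseP] <;> omega)⟩
  · have := T 5 (by simpa only [rot5, theta] using hz) (by simpa only [rot5, theta] using w5)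
      (by simpa only [rot5, theta] using w6) (by simpa only [rot5, theta] using w7)
      (by simpa only [rot5, theta] using w4)
    simp only [rot5, theta] at this
    exact ⟨P.j.toNat, Or.inr (by ext <;> simp only [baseP, theta] <;> omega)⟩
  · have := T 6 (by simpa only [rot6, theta] using hz) (by simpa only [rot6, theta] using w6)
      (by simpa only [rot6, theta] using w7) (by simpa only [rot6, theta] using w0)
      (by simpa only [rot6, theta] using w5)
    simp only [rot6, theta] at this
    exact ⟨P.h.toNat, Or.inl (by ext <;> simp only [baseP] <;> omega)⟩
  · have := T 7 (by simpa only [rot7, theta] using hz) (by simpa only [rot7, theta] using w7)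
      (by simpa only [rot7, theta] using w0) (by simpa only [rot7, theta] using w1)
      (by simpa only [rot7, theta] using w6)
    simp only [rot7, theta] at this
    exact ⟨P.j.toNat, Or.inr (by ext <;> simp only [baseP, theta] <;> omega)⟩

/-! ### The descent: `I(P) − 2·Ĩ(P)·ζ(3) ∈ ℚ` -/

/-- The statement carried through the descent (3.7)–(3.8): "`I = Σ_t β_t I^{(t)} + (rational number)` and
`Ĩ = Σ_t β_t Ĩ^{(t)}` with the same `β_t ∈ ℤ`", i.e. `I − 2Ĩζ(3) ∈ ℚ`. [cite: RhinViola2001, §3 (3.7)–(3.8)] -/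
def Claim (P : Params) : Prop := ∃ a : ℚ, I P = a + 2 * (bInt P : ℝ) * zetaValue 3

/-- The claim when the least of (2.8) is negative: `I ∈ ℚ` and `Ĩ = 0`. [cite: RhinViola2001, §3 p. 278–279] -/
theorem claim_of_aux_neg {P : Params} (hN : P.Nonneg) (hB : P.Balanced) (hneg : ∃ x ∈ P.S, x < 0) : Claim P := by
  obtain ⟨a, ha⟩ := rational_of_aux_neg hN hB hneg
  exact ⟨a, by rw [ha, bInt_eq_zero_of_aux_neg hN hB hneg]; push_cast; ring⟩

/-- The claim passes through a linear decomposition shared by `I` and `Ĩ` ("with the same `β_t ∈ ℤ` in (3.7) and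
(3.8)"). [cite: RhinViola2001, §3 (3.7)–(3.8)] -/
theorem claim_of_rel {P A B C : Params} (hPn : P.Nonneg) (hAn : A.Nonneg) (hBn : B.Nonneg) (hCn : C.Nonneg)
    (hI : I P = I A - I B - I C)
    (hc : contourI P 1 1 1 = contourI A 1 1 1 - contourI B 1 1 1 - contourI C 1 1 1)
    (cA : Claim A) (cB : Claim B) (cC : Claim C) : Claim P := by
  have hb : bInt P = bInt A - bInt B - bInt C := by
    rw [contourI_eq_bInt hPn one_pos one_pos one_pos, contourI_eq_bInt hAn one_pos one_pos one_pos,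
      contourI_eq_bInt hBn one_pos one_pos one_pos, contourI_eq_bInt hCn one_pos one_pos one_pos] at hc
    exact_mod_cast hc
  obtain ⟨a, ha⟩ := cA
  obtain ⟨b, hb'⟩ := cB
  obtain ⟨c, hc'⟩ := cC
  exact ⟨a - b - c, by rw [hI, ha, hb', hc', hb]; push_cast; ring⟩

/-- The claim along `R0`. [cite: RhinViola2001, §3 (3.7)–(3.8) with §2 (2.10)] -/
theorem claim_R0 (h j k l m q r s : ℕ) (hB : (ofNat h j k (l+1) (m+1) (q+1) (r+1) s).Balanced) (cA : Claim (ofNat h j k l m q r s))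
    (cB : Claim (ofNat (h+1) j k l m q (r+1) s)) (cC : Claim (ofNat h (j+1) k (l+1) m q r s)) : Claim (ofNat h j k (l+1) (m+1) (q+1) (r+1) s) :=
  claim_of_rel (nonneg_ofNat _ _ _ _ _ _ _ _) (nonneg_ofNat _ _ _ _ _ _ _ _) (nonneg_ofNat _ _ _ _ _ _ _ _)
    (nonneg_ofNat _ _ _ _ _ _ _ _) (I_R0 h j k l m q r s hB) (contourI_R0 h j k l m q r s one_pos one_pos one_pos)
    cA cB cC

/-- The claim along `R1`. [cite: RhinViola2001, §3 (3.7)–(3.8) with §2 (2.10)] -/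
theorem claim_R1 (h j k l m q r s : ℕ) (hB : (ofNat h j k l (m+1) (q+1) (r+1) (s+1)).Balanced) (cA : Claim (ofNat h j k l m q r s))
    (cB : Claim (ofNat h (j+1) k l m q r (s+1))) (cC : Claim (ofNat h j (k+1) l (m+1) q r s)) : Claim (ofNat h j k l (m+1) (q+1) (r+1) (s+1)) :=
  claim_of_rel (nonneg_ofNat _ _ _ _ _ _ _ _) (nonneg_ofNat _ _ _ _ _ _ _ _) (nonneg_ofNat _ _ _ _ _ _ _ _)
    (nonneg_ofNat _ _ _ _ _ _ _ _) (I_R1 h j k l m q r s hB) (contourI_R1 h j k l m q r s one_pos one_pos one_pos)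
    cA cB cC

/-- The claim along `R2`. [cite: RhinViola2001, §3 (3.7)–(3.8) with §2 (2.10)] -/
theorem claim_R2 (h j k l m q r s : ℕ) (hB : (ofNat (h+1) j k l m (q+1) (r+1) (s+1)).Balanced) (cA : Claim (ofNat h j k l m q r s))
    (cB : Claim (ofNat (h+1) j (k+1) l m q r s)) (cC : Claim (ofNat h j k (l+1) m (q+1) r s)) : Claim (ofNat (h+1) j k l m (q+1) (r+1) (s+1)) :=
  claim_of_rel (nonneg_ofNat _ _ _ _ _ _ _ _) (nonneg_ofNat _ _ _ _ _ _ _ _) (nonneg_ofNat _ _ _ _ _ _ _ _)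
    (nonneg_ofNat _ _ _ _ _ _ _ _) (I_R2 h j k l m q r s hB) (contourI_R2 h j k l m q r s one_pos one_pos one_pos)
    cA cB cC

/-- The claim along `R3`. [cite: RhinViola2001, §3 (3.7)–(3.8) with §2 (2.10)] -/
theorem claim_R3 (h j k l m q r s : ℕ) (hB : (ofNat (h+1) (j+1) k l m q (r+1) (s+1)).Balanced) (cA : Claim (ofNat h j k l m q r s))
    (cB : Claim (ofNat h (j+1) k (l+1) m q r s)) (cC : Claim (ofNat h j k l (m+1) q (r+1) s)) : Claim (ofNat (h+1) (j+1) k l m q (r+1) (s+1)) :=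
  claim_of_rel (nonneg_ofNat _ _ _ _ _ _ _ _) (nonneg_ofNat _ _ _ _ _ _ _ _) (nonneg_ofNat _ _ _ _ _ _ _ _)
    (nonneg_ofNat _ _ _ _ _ _ _ _) (I_R3 h j k l m q r s hB) (contourI_R3 h j k l m q r s one_pos one_pos one_pos)
    cA cB cC

/-- The claim along `R4`. [cite: RhinViola2001, §3 (3.7)–(3.8) with §2 (2.10)] -/
theorem claim_R4 (h j k l m q r s : ℕ) (hB : (ofNat (h+1) (j+1) (k+1) l m q r (s+1)).Balanced) (cA : Claim (ofNat h j k l m q r s))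
    (cB : Claim (ofNat h j (k+1) l (m+1) q r s)) (cC : Claim (ofNat h j k l m (q+1) r (s+1))) : Claim (ofNat (h+1) (j+1) (k+1) l m q r (s+1)) :=
  claim_of_rel (nonneg_ofNat _ _ _ _ _ _ _ _) (nonneg_ofNat _ _ _ _ _ _ _ _) (nonneg_ofNat _ _ _ _ _ _ _ _)
    (nonneg_ofNat _ _ _ _ _ _ _ _) (I_R4 h j k l m q r s hB) (contourI_R4 h j k l m q r s one_pos one_pos one_pos)
    cA cB cC

/-- The claim along `R5`. [cite: RhinViola2001, §3 (3.7)–(3.8) with §2 (2.10)] -/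
theorem claim_R5 (h j k l m q r s : ℕ) (hB : (ofNat (h+1) (j+1) (k+1) (l+1) m q r s).Balanced) (cA : Claim (ofNat h j k l m q r s))
    (cB : Claim (ofNat h j k (l+1) m (q+1) r s)) (cC : Claim (ofNat (h+1) j k l m q (r+1) s)) : Claim (ofNat (h+1) (j+1) (k+1) (l+1) m q r s) :=
  claim_of_rel (nonneg_ofNat _ _ _ _ _ _ _ _) (nonneg_ofNat _ _ _ _ _ _ _ _) (nonneg_ofNat _ _ _ _ _ _ _ _)
    (nonneg_ofNat _ _ _ _ _ _ _ _) (I_R5 h j k l m q r s hB) (contourI_R5 h j k l m q r s one_pos one_pos one_pos)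
    cA cB cC

/-- The claim along `R6`. [cite: RhinViola2001, §3 (3.7)–(3.8) with §2 (2.10)] -/
theorem claim_R6 (h j k l m q r s : ℕ) (hB : (ofNat h (j+1) (k+1) (l+1) (m+1) q r s).Balanced) (cA : Claim (ofNat h j k l m q r s))
    (cB : Claim (ofNat h j k l (m+1) q (r+1) s)) (cC : Claim (ofNat h (j+1) k l m q r (s+1))) : Claim (ofNat h (j+1) (k+1) (l+1) (m+1) q r s) :=
  claim_of_rel (nonneg_ofNat _ _ _ _ _ _ _ _) (nonneg_ofNat _ _ _ _ _ _ _ _) (nonneg_ofNat _ _ _ _ _ _ _ _)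
    (nonneg_ofNat _ _ _ _ _ _ _ _) (I_R6 h j k l m q r s hB) (contourI_R6 h j k l m q r s one_pos one_pos one_pos)
    cA cB cC

/-- The claim along `R7`. [cite: RhinViola2001, §3 (3.7)–(3.8) with §2 (2.10)] -/
theorem claim_R7 (h j k l m q r s : ℕ) (hB : (ofNat h j (k+1) (l+1) (m+1) (q+1) r s).Balanced) (cA : Claim (ofNat h j k l m q r s))
    (cB : Claim (ofNat h j k l m (q+1) r (s+1))) (cC : Claim (ofNat (h+1) j (k+1) l m q r s)) : Claim (ofNat h j (k+1) (l+1) (m+1) (q+1) r s) :=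
  claim_of_rel (nonneg_ofNat _ _ _ _ _ _ _ _) (nonneg_ofNat _ _ _ _ _ _ _ _) (nonneg_ofNat _ _ _ _ _ _ _ _)
    (nonneg_ofNat _ _ _ _ _ _ _ _) (I_R7 h j k l m q r s hB) (contourI_R7 h j k l m q r s one_pos one_pos one_pos)
    cA cB cC

/-- The claim at `(t,0,t,0,t,0,t,0)`: (2.11) `I = −2Σν^{−3} + 2ζ(3)` and `Ĩ = 1`.
[cite: RhinViola2001, §2 (2.11), §3 (3.9)–(3.10)] -/
theorem claim_baseP (t : ℕ) : Claim (baseP t) := by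
  refine ⟨-2 * ∑ ν ∈ Finset.range t, 1 / ((ν : ℚ) + 1) ^ 3, ?_⟩
  rw [I_baseP, bInt_baseP]
  push_cast
  ring

/-- The claim at `(0,t,0,t,0,t,0,t) = ϑ(t,0,t,0,t,0,t,0)`: `I` is `ϑ`-invariant and `Ĩ = 1` there too.
[cite: RhinViola2001, §2 (2.11) and p. 272, §3 (3.9)–(3.10)] -/
theorem claim_theta_baseP (t : ℕ) : Claim (theta (baseP t)) := by
  refine ⟨-2 * ∑ ν ∈ Finset.range t, 1 / ((ν : ℚ) + 1) ^ 3, ?_⟩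
  rw [ThetaInvariance.I_theta _ (balanced_baseP t), I_baseP, bInt_theta_baseP]
  push_cast
  ring

/-- The total weight of an `ofNat` tuple (plumbing). [folklore] -/
private theorem total_ofNat (h j k l m q r s : ℕ) :
    total (ofNat h j k l m q r s) = ((h + j + k + l + m + q + r + s : ℕ) : ℤ) := by
  simp only [total, ofNat]; push_cast; ring

/-- **One step of the descent** — the case distinction of the proof of Theorem 2.1 (pp. 274–275), run simultaneously
for `I` and `Ĩ` as on p. 278. [cite: RhinViola2001, §2 pp. 274–275, §3 p. 278] -/
theorem step (P : Params) (hN : P.Nonneg) (hB : P.Balanced)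
    (IH : ∀ P' : Params, P'.Nonneg → P'.Balanced → total P' < total P → Claim P') : Claim P := by
  by_cases hneg : ∃ x ∈ P.S, x < 0
  · exact claim_of_aux_neg hN hB hneg
  have haux : P.aux.Nonneg := by
    push Not at hneg
    simp only [Params.S, Params.toList, List.forall_mem_cons] at hneg
    obtain ⟨e0, e1, e2, e3, e4, e5, e6, e7, -⟩ := hneg
    exact ⟨e0, e1, e2, e3, e4, e5, e6, e7⟩
  obtain ⟨h, j, k, l, m, q, r, s, rfl⟩ := exists_eq_ofNat hN
  have hB' := (balanced_ofNat_iff _ _ _ _ _ _ _ _).mp hB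
  have IH' : ∀ a b c d e f g i : ℕ, a + e = c + g → b + f = d + i →
      a + b + c + d + e + f + g + i < h + j + k + l + m + q + r + s → Claim (ofNat a b c d e f g i) := by
    intro a b c d e f g i hb1 hb2 hlt
    exact IH _ (nonneg_ofNat _ _ _ _ _ _ _ _) ((balanced_ofNat_iff _ _ _ _ _ _ _ _).mpr ⟨hb1, hb2⟩)
      (by rw [total_ofNat, total_ofNat]; exact_mod_cast hlt)
  by_cases w0 : 0 < l ∧ 0 < m ∧ 0 < q ∧ 0 < r
  · obtain ⟨l, rfl⟩ : ∃ l', l = l' + 1 := ⟨l - 1, by omega⟩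
    obtain ⟨m, rfl⟩ : ∃ m', m = m' + 1 := ⟨m - 1, by omega⟩
    obtain ⟨q, rfl⟩ : ∃ q', q = q' + 1 := ⟨q - 1, by omega⟩
    obtain ⟨r, rfl⟩ : ∃ r', r = r' + 1 := ⟨r - 1, by omega⟩
    exact claim_R0 h j k l m q r s hB (IH' _ _ _ _ _ _ _ _ (by omega) (by omega) (by omega))
      (IH' _ _ _ _ _ _ _ _ (by omega) (by omega) (by omega)) (IH' _ _ _ _ _ _ _ _ (by omega) (by omega) (by omega))
  by_cases w1 : 0 < m ∧ 0 < q ∧ 0 < r ∧ 0 < s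
  · obtain ⟨m, rfl⟩ : ∃ m', m = m' + 1 := ⟨m - 1, by omega⟩
    obtain ⟨q, rfl⟩ : ∃ q', q = q' + 1 := ⟨q - 1, by omega⟩
    obtain ⟨r, rfl⟩ : ∃ r', r = r' + 1 := ⟨r - 1, by omega⟩
    obtain ⟨s, rfl⟩ : ∃ s', s = s' + 1 := ⟨s - 1, by omega⟩
    exact claim_R1 h j k l m q r s hB (IH' _ _ _ _ _ _ _ _ (by omega) (by omega) (by omega))
      (IH' _ _ _ _ _ _ _ _ (by omega) (by omega) (by omega)) (IH' _ _ _ _ _ _ _ _ (by omega) (by omega) (by omega))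
  by_cases w2 : 0 < q ∧ 0 < r ∧ 0 < s ∧ 0 < h
  · obtain ⟨h, rfl⟩ : ∃ h', h = h' + 1 := ⟨h - 1, by omega⟩
    obtain ⟨q, rfl⟩ : ∃ q', q = q' + 1 := ⟨q - 1, by omega⟩
    obtain ⟨r, rfl⟩ : ∃ r', r = r' + 1 := ⟨r - 1, by omega⟩
    obtain ⟨s, rfl⟩ : ∃ s', s = s' + 1 := ⟨s - 1, by omega⟩
    exact claim_R2 h j k l m q r s hB (IH' _ _ _ _ _ _ _ _ (by omega) (by omega) (by omega))
      (IH' _ _ _ _ _ _ _ _ (by omega) (by omega) (by omega)) (IH' _ _ _ _ _ _ _ _ (by omega) (by omega) (by omega))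
  by_cases w3 : 0 < r ∧ 0 < s ∧ 0 < h ∧ 0 < j
  · obtain ⟨h, rfl⟩ : ∃ h', h = h' + 1 := ⟨h - 1, by omega⟩
    obtain ⟨j, rfl⟩ : ∃ j', j = j' + 1 := ⟨j - 1, by omega⟩
    obtain ⟨r, rfl⟩ : ∃ r', r = r' + 1 := ⟨r - 1, by omega⟩
    obtain ⟨s, rfl⟩ : ∃ s', s = s' + 1 := ⟨s - 1, by omega⟩
    exact claim_R3 h j k l m q r s hB (IH' _ _ _ _ _ _ _ _ (by omega) (by omega) (by omega))
      (IH' _ _ _ _ _ _ _ _ (by omega) (by omega) (by omega)) (IH' _ _ _ _ _ _ _ _ (by omega) (by omega) (by omega))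
  by_cases w4 : 0 < s ∧ 0 < h ∧ 0 < j ∧ 0 < k
  · obtain ⟨h, rfl⟩ : ∃ h', h = h' + 1 := ⟨h - 1, by omega⟩
    obtain ⟨j, rfl⟩ : ∃ j', j = j' + 1 := ⟨j - 1, by omega⟩
    obtain ⟨k, rfl⟩ : ∃ k', k = k' + 1 := ⟨k - 1, by omega⟩
    obtain ⟨s, rfl⟩ : ∃ s', s = s' + 1 := ⟨s - 1, by omega⟩
    exact claim_R4 h j k l m q r s hB (IH' _ _ _ _ _ _ _ _ (by omega) (by omega) (by omega))
      (IH' _ _ _ _ _ _ _ _ (by omega) (by omega) (by omega)) (IH' _ _ _ _ _ _ _ _ (by omega) (by omega) (by omega))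
  by_cases w5 : 0 < h ∧ 0 < j ∧ 0 < k ∧ 0 < l
  · obtain ⟨h, rfl⟩ : ∃ h', h = h' + 1 := ⟨h - 1, by omega⟩
    obtain ⟨j, rfl⟩ : ∃ j', j = j' + 1 := ⟨j - 1, by omega⟩
    obtain ⟨k, rfl⟩ : ∃ k', k = k' + 1 := ⟨k - 1, by omega⟩
    obtain ⟨l, rfl⟩ : ∃ l', l = l' + 1 := ⟨l - 1, by omega⟩
    exact claim_R5 h j k l m q r s hB (IH' _ _ _ _ _ _ _ _ (by omega) (by omega) (by omega))
      (IH' _ _ _ _ _ _ _ _ (by omega) (by omega) (by omega)) (IH' _ _ _ _ _ _ _ _ (by omega) (by omega) (by omega))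
  by_cases w6 : 0 < j ∧ 0 < k ∧ 0 < l ∧ 0 < m
  · obtain ⟨j, rfl⟩ : ∃ j', j = j' + 1 := ⟨j - 1, by omega⟩
    obtain ⟨k, rfl⟩ : ∃ k', k = k' + 1 := ⟨k - 1, by omega⟩
    obtain ⟨l, rfl⟩ : ∃ l', l = l' + 1 := ⟨l - 1, by omega⟩
    obtain ⟨m, rfl⟩ : ∃ m', m = m' + 1 := ⟨m - 1, by omega⟩
    exact claim_R6 h j k l m q r s hB (IH' _ _ _ _ _ _ _ _ (by omega) (by omega) (by omega))
      (IH' _ _ _ _ _ _ _ _ (by omega) (by omega) (by omega)) (IH' _ _ _ _ _ _ _ _ (by omega) (by omega) (by omega))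
  by_cases w7 : 0 < k ∧ 0 < l ∧ 0 < m ∧ 0 < q
  · obtain ⟨k, rfl⟩ : ∃ k', k = k' + 1 := ⟨k - 1, by omega⟩
    obtain ⟨l, rfl⟩ : ∃ l', l = l' + 1 := ⟨l - 1, by omega⟩
    obtain ⟨m, rfl⟩ : ∃ m', m = m' + 1 := ⟨m - 1, by omega⟩
    obtain ⟨q, rfl⟩ : ∃ q', q = q' + 1 := ⟨q - 1, by omega⟩
    exact claim_R7 h j k l m q r s hB (IH' _ _ _ _ _ _ _ _ (by omega) (by omega) (by omega))
      (IH' _ _ _ _ _ _ _ _ (by omega) (by omega) (by omega)) (IH' _ _ _ _ _ _ _ _ (by omega) (by omega) (by omega))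
  -- terminal: all eight products vanish
  obtain ⟨t, hP | hP⟩ := terminal_cases (nonneg_ofNat h j k l m q r s) hB haux
    (by simp only [ofNat]; omega) (by simp only [ofNat]; omega) (by simp only [ofNat]; omega)
    (by simp only [ofNat]; omega) (by simp only [ofNat]; omega) (by simp only [ofNat]; omega)
    (by simp only [ofNat]; omega) (by simp only [ofNat]; omega)
  · rw [hP]; exact claim_baseP t
  · rw [hP]; exact claim_theta_baseP t

/-- **The descent**, by strong induction on `h+j+k+l+m+q+r+s` ("if we iterate the linear decomposition (2.10)
sufficiently many times, in finitely many steps …"). [cite: RhinViola2001, §2 p. 275, §3 p. 278] -/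
theorem main : ∀ (n : ℕ) (P : Params), P.Nonneg → P.Balanced → (total P).toNat = n → Claim P := by
  intro n
  induction n using Nat.strong_induction_on with
  | h n ih =>
    intro P hN hB hn
    refine step P hN hB fun P' hN' hB' hlt => ?_
    have h0 := total_nonneg hN'
    have h1 := total_nonneg hN
    exact ih (total P').toNat (by omega) P' hN' hB' rfl

/-- `I(P) − 2Ĩ(P)ζ(3) ∈ ℚ` for every non-negative balanced `P`. [cite: RhinViola2001, §3 (3.7)–(3.10)] -/
theorem claim (P : Params) (hN : P.Nonneg) (hB : P.Balanced) : Claim P :=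
  main _ P hN hB rfl

/-! ### "by the irrationality of `ζ(3)`": Theorem 3.1, and then Lemma 3.1 -/

/-- `a + 2bζ(3) = a′ + 2b′ζ(3)` with `a, a′ ∈ ℚ`, `b, b′ ∈ ℤ` forces `b = b′` (tree: `Apery.irrational_zeta_three`).
[cite: RhinViola2001, §3 p. 279 ("by the irrationality of `ζ(3)`")] -/
theorem int_eq_of_add_zeta_three {a a' : ℚ} {b b' : ℤ}
    (h : (a : ℝ) + 2 * b * zetaValue 3 = a' + 2 * b' * zetaValue 3) : b = b' := by
  by_contra hne
  have hb2 : (2 : ℝ) * b - 2 * b' ≠ 0 := by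
    have : (b : ℝ) ≠ b' := by exact_mod_cast hne
    intro h0; apply this; linarith
  apply irrational_zeta_three
  refine ⟨(a' - a) / (2 * b - 2 * b'), ?_⟩
  push_cast
  rw [div_eq_iff hb2]
  linear_combination -h

/-- **Theorem 3.1 (the value of `b`).** For non-negative balanced parameters, the integer `b` of ANY representation
`I(P) = a + 2bζ(3)` (`a ∈ ℚ`, `b ∈ ℤ`) is `Ĩ(P)` — in closed form, the double binomial sum `bInt P`.
[cite: RhinViola2001, §3 Theorem 3.1] -/
theorem theorem31_b_eq {P : Params} (hN : P.Nonneg) (hB : P.Balanced) {a : ℚ} {b : ℤ}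
    (hab : I P = a + 2 * b * zetaValue 3) : b = bInt P := by
  obtain ⟨a', ha'⟩ := claim P hN hB
  exact int_eq_of_add_zeta_three (hab.symm.trans ha')

/-- **Theorem 3.1** in the form "`b = Ĩ`": for any radii. [cite: RhinViola2001, §3 Theorem 3.1] -/
theorem contourI_eq_b {P : Params} (hN : P.Nonneg) (hB : P.Balanced) {a : ℚ} {b : ℤ}
    (hab : I P = a + 2 * b * zetaValue 3) {ρ₁ ρ₂ ρ₃ : ℝ} (h₁ : 0 < ρ₁) (h₂ : 0 < ρ₂) (h₃ : 0 < ρ₃) :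
    contourI P ρ₁ ρ₂ ρ₃ = b := by
  rw [contourI_eq_bInt hN h₁ h₂ h₃, ← theorem31_b_eq hN hB hab]

end Theorem31

open Literature.NumberTheory.Transcendental (zetaValue) in
/-- **Theorem 3.1 with Lemma 3.1** (Rhin–Viola 2001) — the named fact `theorem31` of `GroupStructure.lean`, PROVED:
for non-negative `h, …, s` with (2.2)–(2.3) and any `ρ₁, ρ₂, ρ₃ > 0`, `Ĩ = b ∈ ℤ` and `I = a + 2bζ(3)` with `a ∈ ℚ`,
`d_M d_N d_Q a ∈ ℤ` (Theorem 2.1, tree `theorem21_holds`). [cite: RhinViola2001, Lemma 3.1 (p. 276), Theorem 3.1 (p. 278), (3.10)] -/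
theorem theorem31_holds : theorem31 := by
  intro P hN hB ρ₁ ρ₂ ρ₃ h₁ h₂ h₃
  obtain ⟨a, b, hab, A, hA⟩ := theorem21_holds P hN hB
  exact ⟨a, b, Theorem31.contourI_eq_b hN hB hab h₁ h₂ h₃, hab, A, hA⟩

/-- **Lemma 3.1, `ϑ`-part**: `Ĩ(h,j,k,l,m,q,r,s) = Ĩ(j,k,l,m,q,r,s,h)` (here a COROLLARY of Theorem 3.1 and the
`ϑ`-invariance of `I`, tree `ThetaInvariance.I_theta`). [cite: RhinViola2001, §3 Lemma 3.1] -/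
theorem lemma31_theta {P : Params} (hN : P.Nonneg) (hB : P.Balanced) {ρ₁ ρ₂ ρ₃ : ℝ} (h₁ : 0 < ρ₁)
    (h₂ : 0 < ρ₂) (h₃ : 0 < ρ₃) : contourI (theta P) ρ₁ ρ₂ ρ₃ = contourI P ρ₁ ρ₂ ρ₃ := by
  obtain ⟨a, b, hab, -⟩ := theorem21_holds P hN hB
  rw [Theorem31.contourI_eq_b hN hB hab h₁ h₂ h₃, Theorem31.contourI_eq_b (nonneg_theta hN) (balanced_theta hB)
    ((ThetaInvariance.I_theta P hB).trans hab) h₁ h₂ h₃]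

/-- **Lemma 3.1, `σ`-part**: `Ĩ(h,j,k,l,m,q,r,s) = Ĩ(k,j,h,s,r,q,m,l)` (a corollary of Theorem 3.1 and the
`σ`-invariance of `I`, tree `invariance_sigma`). [cite: RhinViola2001, §3 Lemma 3.1] -/
theorem lemma31_sigma {P : Params} (hN : P.Nonneg) (hB : P.Balanced) {ρ₁ ρ₂ ρ₃ : ℝ} (h₁ : 0 < ρ₁)
    (h₂ : 0 < ρ₂) (h₃ : 0 < ρ₃) : contourI (sigma P) ρ₁ ρ₂ ρ₃ = contourI P ρ₁ ρ₂ ρ₃ := by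
  obtain ⟨a, b, hab, -⟩ := theorem21_holds P hN hB
  rw [Theorem31.contourI_eq_b hN hB hab h₁ h₂ h₃, Theorem31.contourI_eq_b (nonneg_sigma hN) (balanced_sigma hB)
    ((invariance_sigma hB).trans hab) h₁ h₂ h₃]

end Literature.NumberTheory.Irrationality.RhinViola2001
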